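import Literature.Analysis.InnerProduct.TwoSphereHeatTraceExpansion
import Literature.Analysis.InnerProduct.ThreeSphereHeatTraceExpansion
import HarnessLib

/-!
# The Dirichlet and Neumann hemispheres `S³₊`: `Z_D(t) = ∑_K binom(K+1,2)e^{−tK(K+2)}`, `Z_N(t) = ∑_K binom(K+2,2)e^{−tK(K+2)}`,
# `Z_{D/N} = ½Z_{S³} ∓ ½E` with the BOUNDARY TRACE `E(t) = ∑_{l≥0}(l+1)e^{−t·l(l+2)} = e^t∑_{n≥0} n e^{−tn²}` — an
# Euler–Maclaurin series over the INTEGER grid, `2t∑_{n≥0} n e^{−tn²} = ∑_j ((−1)ʲB_{2j}/j!)tʲ + O(t^∞-asymptotic)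
# = 1 − t/6 − t²/60 − ⋯`; hence McKEAN–SINGER'S (6) IN DIMENSION 3 TO ALL ORDERS:
# `Z_{D/N}(t) = √π/(8t^{3/2}) ∓ 1/(4t) + √π/(8√t) ∓ 5/24 + (√π/16)√t ∓ (19/240)t + ⋯` — the interior invariants at the
# HALF-integers (half of `S³`), the boundary invariants at the INTEGERS; Weyl `#{λ ≤ Λ}/Λ^{3/2} → 1/6`, `ζ_D(0) = −5/24`,
# `ζ_N(0) = −19/24`, and the INTEGER pole `s = 1` (residues `∓¼`) that the closed `S³` does not have

Layer `Literature/Analysis/InnerProduct`, namespace `Literature.Analysis.InnerProduct`; sequel BY IMPORT of rows g40-#1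
(`TwoSphereHeatTraceExpansion.lean`: REUSED the PUBLIC integer-grid Euler–Maclaurin identity with remainder
`tsum_two_mul_nat_mul_exp_eq_eulerMaclaurin` and its uniform remainder bound `exists_abs_integral_bernoulliPer_mul_hermiteFamily_le`,
`summable_two_mul_nat_mul_exp`) and of the tree's `ThreeSphereHeatTraceExpansion.lean` (REUSED `hasSum_threeSphere_multiplicity`,
`hasSum_threeSphere`, `isBigO_threeSphere_heatTrace_expansion`: `Z_{S³} − ∑_{k≤N}((√π/4)/k!)t^{k−3/2} = O(t^{N−1/2})`); companion
of row g40-#3 (`HemisphereHeatTraceExpansion.lean`, the hemispheres `S²₊`, where the roles are swapped: boundary terms at the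
half-integers and given by a theta function). The abstract theory (`HeatTraceExpansionConsequences.lean`,
`HeatTraceZetaContinuation.lean`, `HeatTraceZetaRegularity.lean`) and the generic multiplicity-family lemmas of
`OddSphereHeatTraceExpansion.lean` do the rest, on the index set `κ = Fin (N+2) ⊕ Fin (N+1)`. Lane `lit-hodgefound` (Track 2
foundations library), prover seat `lit-hodgefound-p06` (generation 40), self-proposed row g40-#4. THEOREMS ONLY (no definition,
no instance, no notation, no named fact).

## Sources, verbatim

H. P. McKean, I. M. Singer, *Curvature and the eigenvalues of the Laplacian*, J. Differential Geom. 1 (1967) 43–69, p. 45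
(held text `paper:doi-10-4310-jdg-1214427880`, p0003; proved in their §5, formula (2) p. 53): "Consider now an open
`d`-dimensional manifold `D` with compact `(d−1)`-dimensional boundary `B` … the spectra of `Δ⁻ = Δ | C^∞(D̄) ∩ (u : u = 0 on
B)`, `Δ⁺ = Δ | C^∞(D̄) ∩ (u : u• = 0 on B)` … and the partition function `Z± = sp e^{tΔ±} = ∑ exp(γₙ± t)`. Then, as will be
proved in §5, (6) `(4πt)^{d/2} Z± = the (Riemannian) volume of D ± ¼√(4πt) × the (Riemannian) surface area of B + (t/3) ×
the curvatura integra ∫_D K − (t/6) × the integrated mean curvature ∫_B J + O(t^{3/2})`" and "`O(t^{3/2})` cannot be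
improved" (the OCR of the held page prints the error term as `o(t^{3/2})`; the remark, the parallel "(5a) … `O(t³)` cannot
be improved" on p. 44, and the nonzero `t^{3/2}`-coefficients proved here and in row g40-#3 fix the reading `O`).
For `D = S³₊` (`d = 3`): `vol D = π²`, `area B = vol S² = 4π`, so `Z∓(t) = π²/(4πt)^{3/2} ∓ ¼√(4πt)·4π/(4πt)^{3/2} + ⋯ =
√π/(8t^{3/2}) ∓ 1/(4t) + ⋯` — the two leading terms below.
P. Freitas, J. Mao, I. Salavessa, *Pólya-type inequalities on spheres and hemispheres*, Ann. Inst. Fourier (2025),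
arXiv:2204.07277 (held text `paper:arxiv-2204.07277`), §2.2 (chunk p0006): "The distinct eigenvalues of `S^n_+` are given by
`λ̄_K = K(K+n−1)`, `K = 1, 2, …`, with multiplicity `m(K) = binom(n+K−2, n−1)`" (`n = 3`: `K(K+2)` with multiplicity
`binom(K+1, 2)` — the Dirichlet family `⟨l, c⟩ ↦ l(l+2)` on `Σ l, Fin (binom(l+1,2))`), and §1.3 (chunk p0004): "the spectrum
of `Sⁿ` consists of the union of the Dirichlet and Neumann spectra on `Sⁿ₊`" (so the Neumann multiplicity of `K(K+2)` is
`(K+1)² − binom(K+1,2) = binom(K+2,2)`; `tsum_dirichletThreeHemisphere_add_tsum_neumannThreeHemisphere`).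
K. Kirsten, *Spectral Functions in Mathematics and Physics* (2001), §3.2 eq. (3.2.19) (`λ_l = l(l+d−1)` on `S^d` with degeneracy
`(2l+d−1)(l+d−2)!/(l!(d−1)!)`; `d = 3`: `(l+1)²`).
P. J. Davis, P. Rabinowitz, *Methods of Numerical Integration*, 2nd ed. (1984), Sect. 2.9 (2.9.14)–(2.9.17) (the Euler–Maclaurin
formula with the periodic-Bernoulli remainder), as used in row g40-#1; R. K. Pathria, P. D. Beale, *Statistical Mechanics*,
3rd ed. (2011), §6.5 (19)–(20) (the same summation applied to the rotational partition function).
P. H. Bérard, *Spectral Geometry* (LNM 1207, 1986), Ch. VII nº2 Theorem (ii) (`a₀ = Vol`), nº10 (ii) (11) (Weyl's formula).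
P. B. Gilkey, *Invariance theory …* (2nd ed., 1995), §1.10 Lemma 1.10.1 (poles of `Γ(s)ζ(s,P)`, residues `aₙΓ((m−n)/d)^{−1}`,
regular values at `s = 0, −1, …`, zero modes).

## The computation

(1) Euler–Maclaurin with remainder for `h(u) = 2u e^{−(su)²/2}`, `s = √(2t)` (row g40-#1, §4): `∑_{i≥0} 2i e^{−ti²} = 1/t −
∑_{m<ν}(B_{2m+2}/(2m+2)!)·2(−1)ᵐ(2m+1)!!(2t)ᵐ + I_ν(s)/(2ν+1)!` with `|I_ν(s)| ≤ C_ν s^{2ν−1}`; since `(2m+2)! = 2^{m+1}(m+1)!(2m+1)!!`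
the `m`-th term times `t` is `−c_{m+1}t^{m+1}`, `c_j = (−1)ʲB_{2j}/j!`, so `2t∑_{n≥0} n e^{−tn²} − ∑_{j≤ν} c_j tʲ = O(t^{ν+1})`
(`c₀ = 1`, `c₁ = −1/6`, `c₂ = −1/60`, `c₃ = −1/252`). (2) `l(l+2) = (l+1)² − 1`: `E(t) = ∑(l+1)e^{−t·l(l+2)} = e^t∑_{n≥0} n e^{−tn²}`,
`Z_D = ∑ binom(l+1,2)e^{−t·l(l+2)} = ½(∑(l+1)²e^{…} − E) = ½(Z_{S³} − E)`, `Z_N = ½(Z_{S³} + E)`. (3) The Cauchy product of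
`e^t = ∑ tᵃ/a!` with `∑ c_b t^b`: `2tE(t) − ∑_{j≤N} d_j tʲ = O(t^{N+1})`, `d_j = ∑_{a+b=j}(1/a!)c_b` (`d₀ = 1`, `d₁ = 5/6`,
`d₂ = 19/60`), i.e. `E − ½∑_{j≤N} d_j t^{j−1} = O(t^N)`. (4) With `Z_{S³} − ∑_{k≤N+1}((√π/4)/k!)t^{k−3/2} = O(t^{N+1/2})`:
`Z_{D/N} − [∑_{k≤N+1}((√π/8)/k!)t^{k−3/2} ∓ ¼∑_{j≤N} d_j t^{j−1}] = O(t^N)`. (5) The machinery: Weyl with `ρ = 3/2`: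
`(√π/8)/Γ(5/2) = 1/6`; at `s = 0` only `t⁰ = t^{1−1}`: `ζ_D(0) = −¼d₁ − 0 = −5/24`, `ζ_N(0) = ¼d₁ − 1 = −19/24`; residues
`Γ(1)^{−1}(∓¼d₀) = ∓¼` at `s = 1`, `Γ(3/2)^{−1}√π/8 = ¼` at `s = 3/2`; `ζ_D(−j) = (−1)ʲj!·(−¼d_{j+1})`.

## What is proved

* §1 `summable_nat_mul_exp_neg_mul_sq`, `two_mul_mul_tsum_nat_mul_exp_neg_mul_sq`,
  **`isBigO_mul_tsum_nat_mul_exp_neg_mul_sq_sub`** (`2t∑n e^{−tn²} − ∑_{j≤ν}((−1)ʲB_{2j}/j!)tʲ = O(t^{ν+1})`, every `ν`),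
  `isBigO_mul_tsum_nat_mul_exp_neg_mul_sq_sub_three` (`= 1 − t/6 − t²/60 + O(t³)`); private `cast_factorial_two_mul_add_two'`,
  `eulerMaclaurin_intCoeff_eq`, `bernoulli_four'`.
* §2 **`hasSum_threeHemisphere_boundaryTrace`** (`E = e^t∑ n e^{−tn²}`), **`hasSum_dirichletThreeHemisphere_multiplicity`**
  (`Z_D = ½(Z_{S³} − E)`), **`hasSum_neumannThreeHemisphere_multiplicity`** (`Z_N = ½(Z_{S³} + E)`), the families on
  `Σ l, Fin (binom(l+1,2))` ∕ `Σ l, Fin (binom(l+2,2))` (`hasSum_/summable_…`, cofinite limits, zero modes `0` ∕ `1`),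
  `tsum_dirichletThreeHemisphere_add_tsum_neumannThreeHemisphere` (`Z_D + Z_N = Z_{S³}`),
  `tsum_neumannThreeHemisphere_sub_tsum_dirichletThreeHemisphere` (`Z_N − Z_D = E`).
* §3 **`isBigO_threeHemisphere_boundaryTrace_sub`** (`E − ½∑_{j≤N} d_j t^{j−1} = O(t^N)`), `threeHemisphere_boundaryCoeff_zero/one/two`
  (`1`, `5/6`, `19/60`), `isBigO_threeHemisphere_boundaryTrace_sub_three` (`E = 1/(2t) + 5/12 + (19/120)t + O(t²)`); private
  `isBigO_eval_sub_sum_coeff'`, `isBigO_exp_sub_sum'`.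
* §4 **`isBigO_dirichletThreeHemisphere_heatTrace_expansion`**, **`isBigO_neumannThreeHemisphere_heatTrace_expansion`** (all
  orders on `Fin (N+2) ⊕ Fin (N+1)`), **`isBigO_neumannThreeHemisphere_sub_dirichletThreeHemisphere`**,
  **`isBigO_dirichletThreeHemisphere_heatTrace_sub_mcKeanSinger`** ∕ **`isBigO_neumannThreeHemisphere_heatTrace_sub_mcKeanSinger`**
  (`Z_{D/N} = √π/(8t^{3/2}) ∓ 1/(4t) + √π/(8√t) ∓ 5/24 + O(√t)`); private `isBigO_half_threeSphere_add_mul_E_sub`.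
* §5 **`tendsto_ncard_dirichletThreeHemisphere_le_div_rpow`** ∕ **`…neumann…`** (WEYL `→ 1/6`),
  **`tendsto_dirichletThreeHemisphereZeta_continuation_nhdsNE_zero`** (`ζ_D(0) = −5/24`),
  **`tendsto_neumannThreeHemisphereZeta_continuation_nhdsNE_zero`** (`ζ_N(0) = −19/24`),
  **`tendsto_sub_one_mul_dirichletThreeHemisphereZeta_continuation`** ∕ **`…neumann…`** (residues `∓¼` at `s = 1`),
  **`tendsto_sub_three_halves_mul_dirichletThreeHemisphereZeta_continuation`** (residue `¼` at `s = 3/2`),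
  **`exists_analyticAt_dirichletThreeHemisphereZeta_continuation_neg_natCast`** (`ζ_D(−j) = (−1)ʲj!·(−¼d_{j+1})`); private
  exponent bookkeeping and `Gamma_five_halves`.

## References

* [McKeanSinger1967] H. P. McKean, I. M. Singer, *Curvature and the eigenvalues of the Laplacian*, J. Differential Geom. 1
  (1967) 43–69, eq. (6) p. 45 and §5 (2) p. 53.
* [FreitasMaoSalavessa2025] P. Freitas, J. Mao, I. Salavessa, *Pólya-type inequalities on spheres and hemispheres*, Ann. Inst.
  Fourier (2025), arXiv:2204.07277, §1.3, §2.2.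
* [Kirsten2001] K. Kirsten, *Spectral Functions in Mathematics and Physics*, Chapman & Hall/CRC (2001), §3.2 (3.2.19).
* [DavisRabinowitz1984] P. J. Davis, P. Rabinowitz, *Methods of Numerical Integration*, 2nd ed. (1984), Sect. 2.9.
* [PathriaBeale2011] R. K. Pathria, P. D. Beale, *Statistical Mechanics*, 3rd ed. (2011), §6.5 (19)–(20).
* [Berard1986] P. H. Bérard, *Spectral Geometry: Direct and Inverse Problems*, LNM 1207 (1986), Ch. VII nº2, nº10 (ii).
* [Gilkey1995] P. B. Gilkey, *Invariance theory, the heat equation, and the Atiyah–Singer index theorem*, 2nd ed. (1995),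
  §1.10 Lemma 1.10.1.
-/

noncomputable section

open Real Filter Topology Set Asymptotics MeasureTheory Polynomial

namespace Literature.Analysis.InnerProduct

/-! ### §1 The odd-weight theta sum over the INTEGERS to all orders: `2t·∑_{n≥0} n e^{−tn²} − ∑_{j≤ν} c_j tʲ = O(t^{ν+1})`,
`c_j = (−1)ʲB_{2j}/j!` (`1 − t/6 − t²/60 − t³/252 − ⋯`) -/

/-- `(2m+2)! = 2^{m+1}(m+1)!(2m+1)!!`. [folklore] -/
private theorem cast_factorial_two_mul_add_two' (m : ℕ) :
    (((2 * m + 2).factorial : ℕ) : ℝ) = 2 ^ (m + 1) * ((m + 1).factorial : ℝ) * ((2 * m + 1).doubleFactorial : ℝ) := by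
  have h : (2 * m + 2).factorial = 2 ^ (m + 1) * (m + 1).factorial * (2 * m + 1).doubleFactorial := by
    rw [show 2 * m + 2 = (2 * m + 1) + 1 by ring, Nat.factorial_eq_mul_doubleFactorial,
      show 2 * m + 1 + 1 = 2 * (m + 1) by ring, Nat.doubleFactorial_two_mul]
  exact_mod_cast h

/-- The `m`-th Euler–Maclaurin term of the integer-grid sum, `t·(B_{2m+2}/(2m+2)!)·2(−1)ᵐ(2m+1)!!·s^{2m}` with `s² = 2t`, is
`−c_{m+1}t^{m+1}`, `c_j = (−1)ʲB_{2j}/j!`. [folklore] -/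
private theorem eulerMaclaurin_intCoeff_eq (m : ℕ) {s t : ℝ} (h2 : s ^ 2 = 2 * t) :
    t * ((bernoulli (2 * m + 2) : ℝ) / (2 * m + 2).factorial *
        (2 * (-1 : ℝ) ^ m * s ^ (2 * m) * ((2 * m + 1).doubleFactorial : ℝ))) =
      -(((-1 : ℝ) ^ (m + 1) * (bernoulli (2 * (m + 1)) : ℝ) / ((m + 1).factorial : ℝ)) * t ^ (m + 1)) := by
  rw [cast_factorial_two_mul_add_two', show 2 * (m + 1) = 2 * m + 2 by ring, pow_mul, h2, mul_pow]
  have h1 : ((m + 1).factorial : ℝ) ≠ 0 := by positivity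
  have h3 : ((2 * m + 1).doubleFactorial : ℝ) ≠ 0 := by positivity
  field_simp
  ring

/-- **Summability of the odd-weight Gaussian sum over `ℕ`**: `∑_{n≥0} n e^{−tn²}` converges for `t > 0` (on `S³₊` this is
`e^{−t}·(Z_N − Z_D)(t)`). [cite: PathriaBeale2011, §6.5 eq. (16) (the rotational sums); DavisRabinowitz1984, Sect. 2.9] -/
theorem summable_nat_mul_exp_neg_mul_sq {t : ℝ} (ht : 0 < t) :
    Summable fun n : ℕ ↦ (n : ℝ) * rexp (-(t * ((n : ℝ)) ^ 2)) := by
  have hs : √(2 * t) ≠ 0 := by positivity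
  have h2 : (√(2 * t)) ^ 2 = 2 * t := Real.sq_sqrt (by positivity)
  refine ((summable_two_mul_nat_mul_exp hs).mul_left (1 / 2)).congr fun n ↦ ?_
  rw [show (√(2 * t) * n) ^ 2 / 2 = (√(2 * t)) ^ 2 / 2 * ((n : ℝ)) ^ 2 by ring, h2]
  ring_nf

/-- The integer-grid sum in the variable of row g40-#1: `2t·∑_{n≥0} n e^{−tn²} = t·∑_{i≥0} 2i e^{−(si)²/2}` with `s = √(2t)`.
[cite: PathriaBeale2011, §6.5 eq. (16)] -/
theorem two_mul_mul_tsum_nat_mul_exp_neg_mul_sq {t : ℝ} (ht : 0 < t) :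
    2 * t * ∑' n : ℕ, (n : ℝ) * rexp (-(t * ((n : ℝ)) ^ 2)) =
      t * ∑' i : ℕ, 2 * (i : ℝ) * rexp (-((√(2 * t) * i) ^ 2 / 2)) := by
  have h2 : (√(2 * t)) ^ 2 = 2 * t := Real.sq_sqrt (by positivity)
  have e : ∀ n : ℕ, 2 * (n : ℝ) * rexp (-((√(2 * t) * n) ^ 2 / 2)) = 2 * ((n : ℝ) * rexp (-(t * ((n : ℝ)) ^ 2))) := by
    intro n
    rw [show (√(2 * t) * n) ^ 2 / 2 = (√(2 * t)) ^ 2 / 2 * ((n : ℝ)) ^ 2 by ring, h2]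
    ring_nf
  rw [tsum_congr e, tsum_mul_left]
  ring

/-- **`2t·∑_{n≥0} n e^{−tn²} − ∑_{j≤ν} c_j tʲ = O(t^{ν+1})` as `t → 0⁺`, for every `ν`, `c_j = (−1)ʲB_{2j}/j!`** (`c₀ = 1`,
`c₁ = −1/6`, `c₂ = −1/60`, `c₃ = −1/252`; `∑_j c_j tʲ` is the formal series of `t/(1 − e^{−t}) − t/2 = (t/2)coth(t/2)` read
with `B_{2j}/j!` in place of `B_{2j}/(2j)!` — a genuinely ASYMPTOTIC, factorially divergent series): Euler–Maclaurin
summation with remainder for `h(u) = 2u e^{−tu²}` over the integer grid (`∫₀^∞ h = 1/t`, `h^{(2m+1)}(0) = 2(−1)ᵐ(2m+1)!!(2t)ᵐ`),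
the remainder bounded uniformly by row g40-#1. [cite: PathriaBeale2011, §6.5 eqs. (19)–(20) (the method); DavisRabinowitz1984,
Sect. 2.9 (2.9.14)–(2.9.17)] -/
theorem isBigO_mul_tsum_nat_mul_exp_neg_mul_sq_sub (ν : ℕ) :
    (fun t : ℝ ↦ 2 * t * ∑' n : ℕ, (n : ℝ) * rexp (-(t * ((n : ℝ)) ^ 2)) -
      ∑ j ∈ Finset.range (ν + 1), ((-1 : ℝ) ^ j * (bernoulli (2 * j) : ℝ) / (j.factorial : ℝ)) * t ^ j)
      =O[𝓝[>] 0] fun t : ℝ ↦ t ^ (ν + 1) := by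
  obtain ⟨C, hC, hI⟩ := exists_abs_integral_bernoulliPer_mul_hermiteFamily_le (ν + 1)
  set c : ℕ → ℝ := fun j ↦ (-1 : ℝ) ^ j * (bernoulli (2 * j) : ℝ) / (j.factorial : ℝ) with hc
  refine IsBigO.of_bound (|c (ν + 1)| + C * 2 ^ (ν + 1)) ?_
  filter_upwards [Ioc_mem_nhdsGT (show (0 : ℝ) < 1 / 2 by norm_num)] with t ht
  have ht0 : 0 < t := ht.1
  set s : ℝ := √(2 * t) with hs_def
  have hs : 0 < s := Real.sqrt_pos.mpr (by positivity)
  have h2 : s ^ 2 = 2 * t := Real.sq_sqrt (by positivity)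
  -- the exact Euler–Maclaurin identity of row g40-#1 and its uniform remainder bound, the integral kept anonymous
  obtain ⟨I, hexact, hIb⟩ : ∃ I : ℝ, ∑' i : ℕ, 2 * (i : ℝ) * rexp (-((s * i) ^ 2 / 2)) = 2 / s ^ 2 -
      ∑ m ∈ Finset.range (ν + 1), (bernoulli (2 * m + 2) : ℝ) / (2 * m + 2).factorial *
        (2 * (-1 : ℝ) ^ m * s ^ (2 * m) * ((2 * m + 1).doubleFactorial : ℝ)) + 1 / (2 * (ν + 1) + 1).factorial * I ∧
      |I| ≤ C * s ^ (2 * (ν + 1)) / s :=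
    ⟨_, tsum_two_mul_nat_mul_exp_eq_eulerMaclaurin hs (ν + 1), hI s hs⟩
  -- the main terms
  have hmain : t * (2 / s ^ 2) = c 0 * t ^ 0 := by
    rw [h2, hc]
    simp only [pow_zero, mul_zero, _root_.bernoulli_zero, Rat.cast_one, Nat.factorial_zero, Nat.cast_one, div_one, mul_one]
    field_simp
  have hsum : t * ∑ m ∈ Finset.range (ν + 1), (bernoulli (2 * m + 2) : ℝ) / (2 * m + 2).factorial *
      (2 * (-1 : ℝ) ^ m * s ^ (2 * m) * ((2 * m + 1).doubleFactorial : ℝ)) =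
      -∑ m ∈ Finset.range (ν + 1), c (m + 1) * t ^ (m + 1) := by
    rw [Finset.mul_sum, ← Finset.sum_neg_distrib]
    exact Finset.sum_congr rfl fun m _ ↦ eulerMaclaurin_intCoeff_eq m h2
  have hid : 2 * t * ∑' n : ℕ, (n : ℝ) * rexp (-(t * ((n : ℝ)) ^ 2)) - ∑ j ∈ Finset.range (ν + 1), c j * t ^ j =
      c (ν + 1) * t ^ (ν + 1) + t / (2 * (ν + 1) + 1).factorial * I := by
    rw [two_mul_mul_tsum_nat_mul_exp_neg_mul_sq ht0, ← hs_def, hexact, mul_add, mul_sub, hmain, hsum,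
      Finset.sum_range_succ' (fun j ↦ c j * t ^ j), Finset.sum_range_succ (fun m ↦ c (m + 1) * t ^ (m + 1))]
    ring
  -- the remainder
  have hts : t / s ≤ 1 := by
    rw [div_le_one hs]
    have : t ^ 2 ≤ s ^ 2 := by rw [h2]; nlinarith [ht.2]
    nlinarith [this, hs]
  have hrem : |t / (2 * (ν + 1) + 1).factorial * I| ≤ C * 2 ^ (ν + 1) * t ^ (ν + 1) := by
    have hfac : (1 : ℝ) ≤ (2 * (ν + 1) + 1).factorial := by
      exact_mod_cast Nat.one_le_iff_ne_zero.mpr (Nat.factorial_ne_zero _)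
    have hpow : C * s ^ (2 * (ν + 1)) / s = C * 2 ^ (ν + 1) * t ^ (ν + 1) / s := by
      rw [pow_mul, h2, mul_pow]; ring
    calc |t / (2 * (ν + 1) + 1).factorial * I| = t / (2 * (ν + 1) + 1).factorial * |I| := by
          rw [abs_mul, abs_of_pos (by positivity)]
      _ ≤ t / 1 * (C * 2 ^ (ν + 1) * t ^ (ν + 1) / s) := by
          rw [← hpow]; gcongr
      _ = C * 2 ^ (ν + 1) * t ^ (ν + 1) * (t / s) := by field_simp
      _ ≤ C * 2 ^ (ν + 1) * t ^ (ν + 1) * 1 := by gcongr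
      _ = _ := mul_one _
  rw [Real.norm_eq_abs, Real.norm_eq_abs, hid, abs_of_pos (pow_pos ht0 _)]
  calc |c (ν + 1) * t ^ (ν + 1) + t / (2 * (ν + 1) + 1).factorial * I|
      ≤ |c (ν + 1) * t ^ (ν + 1)| + |t / (2 * (ν + 1) + 1).factorial * I| := abs_add_le _ _
    _ ≤ |c (ν + 1)| * t ^ (ν + 1) + C * 2 ^ (ν + 1) * t ^ (ν + 1) := by
        rw [abs_mul, abs_of_pos (pow_pos ht0 _)]
        gcongr
    _ = (|c (ν + 1)| + C * 2 ^ (ν + 1)) * t ^ (ν + 1) := by ring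

/-- `B₄ = −1/30`. [folklore] -/
private theorem bernoulli_four' : _root_.bernoulli 4 = -1 / 30 := by
  rw [bernoulli_eq_bernoulli'_of_ne_one (by norm_num), bernoulli'_four]

/-- **The printed first terms: `2t·∑_{n≥0} n e^{−tn²} = 1 − t/6 − t²/60 + O(t³)`.** [cite: DavisRabinowitz1984, Sect. 2.9
(2.9.14); PathriaBeale2011, §6.5 (19)] -/
theorem isBigO_mul_tsum_nat_mul_exp_neg_mul_sq_sub_three :
    (fun t : ℝ ↦ 2 * t * ∑' n : ℕ, (n : ℝ) * rexp (-(t * ((n : ℝ)) ^ 2)) - (1 - t / 6 - t ^ 2 / 60))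
      =O[𝓝[>] 0] fun t : ℝ ↦ t ^ 3 := by
  refine (isBigO_mul_tsum_nat_mul_exp_neg_mul_sq_sub 2).congr' ?_ EventuallyEq.rfl
  filter_upwards with t
  rw [Finset.sum_range_succ, Finset.sum_range_succ, Finset.sum_range_one]
  simp only [pow_zero, mul_zero, _root_.bernoulli_zero, Nat.factorial_zero, Nat.cast_one, pow_one, mul_one,
    _root_.bernoulli_two, Nat.factorial_one, show 2 * 2 = 4 from rfl, bernoulli_four', Nat.factorial_two]
  push_cast
  ring

/-! ### §2 The spectra of the hemispheres `S³₊`: `K(K+2)` with Dirichlet multiplicity `binom(K+1, 2)` and Neumann multiplicity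
`binom(K+2, 2)`; `Z_{D/N} = ½(Z_{S³} ∓ E)` with `E(t) = ∑_{l≥0}(l+1)e^{−t·l(l+2)} = e^t∑_{n≥0} n e^{−tn²}` -/

/-- **`E(t) = ∑_{l≥0}(l+1)e^{−t·l(l+2)} = e^t·∑_{n≥0} n e^{−tn²}`** (`l(l+2) = (l+1)² − 1`, `n = l+1`, the `n = 0` term vanishes).
[cite: FreitasMaoSalavessa2025, §1.3 (`Spec Sⁿ = Spec_D Sⁿ₊ ∪ Spec_N Sⁿ₊`), §2.2] -/
theorem hasSum_threeHemisphere_boundaryTrace {t : ℝ} (ht : 0 < t) :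
    HasSum (fun l : ℕ ↦ ((l : ℝ) + 1) * rexp (-(t * ((l : ℝ) * (l + 2)))))
      (rexp t * ∑' n : ℕ, (n : ℝ) * rexp (-(t * ((n : ℝ)) ^ 2))) := by
  have h0 := (summable_nat_mul_exp_neg_mul_sq ht).hasSum
  have h1 := (hasSum_nat_add_iff' (f := fun n : ℕ ↦ (n : ℝ) * rexp (-(t * ((n : ℝ)) ^ 2))) 1).mpr h0
  simp only [Finset.range_one, Finset.sum_singleton, Nat.cast_zero, zero_mul, sub_zero, Nat.cast_add, Nat.cast_one] at h1
  refine (h1.mul_left (rexp t)).congr_fun fun l ↦ ?_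
  rw [show rexp t * (((l : ℝ) + 1) * rexp (-(t * ((l : ℝ) + 1) ^ 2))) =
    ((l : ℝ) + 1) * (rexp t * rexp (-(t * ((l : ℝ) + 1) ^ 2))) by ring, ← Real.exp_add]
  congr 2
  ring

/-- **THE DIRICHLET HEMISPHERE `S³₊` WITH MULTIPLICITIES: `∑_K binom(K+1,2)e^{−tK(K+2)} = ½(Z_{S³}(t) − E(t))`** — "the distinct
eigenvalues of `Sⁿ₊` are `λ̄_K = K(K+n−1)` … with multiplicity `m(K) = binom(n+K−2, n−1)`" at `n = 3`, and `binom(K+1,2) =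
½((K+1)² − (K+1))`. [cite: FreitasMaoSalavessa2025, §2.2; Kirsten2001, §3.2 eq. (3.2.19) (`(K+1)²` on `S³`)] -/
theorem hasSum_dirichletThreeHemisphere_multiplicity {t : ℝ} (ht : 0 < t) :
    HasSum (fun l : ℕ ↦ (((l + 1).choose 2 : ℕ) : ℝ) * rexp (-(t * ((l : ℝ) * (l + 2)))))
      (1 / 2 * (rexp t / 2 * ∑' n : ℤ, ((n : ℝ)) ^ 2 * rexp (-(t * ((n : ℝ)) ^ 2)) -
        rexp t * ∑' n : ℕ, (n : ℝ) * rexp (-(t * ((n : ℝ)) ^ 2)))) := by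
  have h := ((hasSum_threeSphere_multiplicity ht).sub (hasSum_threeHemisphere_boundaryTrace ht)).mul_left (1 / 2)
  refine h.congr_fun fun l ↦ ?_
  rw [Nat.cast_choose_two]
  push_cast
  ring

/-- **THE NEUMANN HEMISPHERE `S³₊` WITH MULTIPLICITIES: `∑_K binom(K+2,2)e^{−tK(K+2)} = ½(Z_{S³}(t) + E(t))`** (the Neumann
multiplicity is `(K+1)² − binom(K+1,2) = binom(K+2,2)`, since `Spec S³ = Spec_D ∪ Spec_N`). [cite: FreitasMaoSalavessa2025, §1.3,
§2.2; Kirsten2001, §3.2 eq. (3.2.19)] -/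
theorem hasSum_neumannThreeHemisphere_multiplicity {t : ℝ} (ht : 0 < t) :
    HasSum (fun l : ℕ ↦ (((l + 2).choose 2 : ℕ) : ℝ) * rexp (-(t * ((l : ℝ) * (l + 2)))))
      (1 / 2 * (rexp t / 2 * ∑' n : ℤ, ((n : ℝ)) ^ 2 * rexp (-(t * ((n : ℝ)) ^ 2)) +
        rexp t * ∑' n : ℕ, (n : ℝ) * rexp (-(t * ((n : ℝ)) ^ 2)))) := by
  have h := ((hasSum_threeSphere_multiplicity ht).add (hasSum_threeHemisphere_boundaryTrace ht)).mul_left (1 / 2)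
  refine h.congr_fun fun l ↦ ?_
  rw [Nat.cast_choose_two]
  push_cast
  ring

/-- The Dirichlet hemisphere `S³₊` as a family on `Σ l, Fin (binom(l+1,2))`. [cite: FreitasMaoSalavessa2025, §2.2] -/
theorem hasSum_dirichletThreeHemisphere {t : ℝ} (ht : 0 < t) :
    HasSum (fun i : (Σ l : ℕ, Fin ((l + 1).choose 2)) ↦ rexp (-(t * ((i.1 : ℝ) * (i.1 + 2)))))
      (1 / 2 * (rexp t / 2 * ∑' n : ℤ, ((n : ℝ)) ^ 2 * rexp (-(t * ((n : ℝ)) ^ 2)) -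
        rexp t * ∑' n : ℕ, (n : ℝ) * rexp (-(t * ((n : ℝ)) ^ 2)))) :=
  hasSum_sigma_fin_of_hasSum_natCast_mul (d := fun l ↦ (l + 1).choose 2)
    (f := fun l : ℕ ↦ rexp (-(t * ((l : ℝ) * (l + 2))))) (fun _ ↦ (Real.exp_pos _).le)
    (hasSum_dirichletThreeHemisphere_multiplicity ht)

/-- The Neumann hemisphere `S³₊` as a family on `Σ l, Fin (binom(l+2,2))`. [cite: FreitasMaoSalavessa2025, §1.3, §2.2] -/
theorem hasSum_neumannThreeHemisphere {t : ℝ} (ht : 0 < t) :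
    HasSum (fun i : (Σ l : ℕ, Fin ((l + 2).choose 2)) ↦ rexp (-(t * ((i.1 : ℝ) * (i.1 + 2)))))
      (1 / 2 * (rexp t / 2 * ∑' n : ℤ, ((n : ℝ)) ^ 2 * rexp (-(t * ((n : ℝ)) ^ 2)) +
        rexp t * ∑' n : ℕ, (n : ℝ) * rexp (-(t * ((n : ℝ)) ^ 2)))) :=
  hasSum_sigma_fin_of_hasSum_natCast_mul (d := fun l ↦ (l + 2).choose 2)
    (f := fun l : ℕ ↦ rexp (-(t * ((l : ℝ) * (l + 2))))) (fun _ ↦ (Real.exp_pos _).le)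
    (hasSum_neumannThreeHemisphere_multiplicity ht)

/-- Summability of the Dirichlet family. [cite: FreitasMaoSalavessa2025, §2.2] -/
theorem summable_dirichletThreeHemisphere {t : ℝ} (ht : 0 < t) :
    Summable fun i : (Σ l : ℕ, Fin ((l + 1).choose 2)) ↦ rexp (-(t * ((i.1 : ℝ) * (i.1 + 2)))) :=
  (hasSum_dirichletThreeHemisphere ht).summable

/-- Summability of the Neumann family. [cite: FreitasMaoSalavessa2025, §1.3, §2.2] -/
theorem summable_neumannThreeHemisphere {t : ℝ} (ht : 0 < t) :
    Summable fun i : (Σ l : ℕ, Fin ((l + 2).choose 2)) ↦ rexp (-(t * ((i.1 : ℝ) * (i.1 + 2)))) :=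
  (hasSum_neumannThreeHemisphere ht).summable

/-- **`Z_D + Z_N = Z_{S³}`** on the families. [cite: FreitasMaoSalavessa2025, §1.3] -/
theorem tsum_dirichletThreeHemisphere_add_tsum_neumannThreeHemisphere {t : ℝ} (ht : 0 < t) :
    ∑' i : (Σ l : ℕ, Fin ((l + 1).choose 2)), rexp (-(t * ((i.1 : ℝ) * (i.1 + 2)))) +
      ∑' i : (Σ l : ℕ, Fin ((l + 2).choose 2)), rexp (-(t * ((i.1 : ℝ) * (i.1 + 2)))) =
      ∑' i : (Σ l : ℕ, Fin (l + 1) × Fin (l + 1)), rexp (-(t * ((i.1 : ℝ) * (i.1 + 2)))) := by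
  rw [(hasSum_dirichletThreeHemisphere ht).tsum_eq, (hasSum_neumannThreeHemisphere ht).tsum_eq, (hasSum_threeSphere ht).tsum_eq]
  ring

/-- **`Z_N − Z_D = E = e^t∑_{n≥0} n e^{−tn²}`**. [cite: FreitasMaoSalavessa2025, §1.3, §2.2] -/
theorem tsum_neumannThreeHemisphere_sub_tsum_dirichletThreeHemisphere {t : ℝ} (ht : 0 < t) :
    ∑' i : (Σ l : ℕ, Fin ((l + 2).choose 2)), rexp (-(t * ((i.1 : ℝ) * (i.1 + 2)))) -
      ∑' i : (Σ l : ℕ, Fin ((l + 1).choose 2)), rexp (-(t * ((i.1 : ℝ) * (i.1 + 2)))) =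
      rexp t * ∑' n : ℕ, (n : ℝ) * rexp (-(t * ((n : ℝ)) ^ 2)) := by
  rw [(hasSum_dirichletThreeHemisphere ht).tsum_eq, (hasSum_neumannThreeHemisphere ht).tsum_eq]
  ring

/-- `l(l+2) → ∞`. [folklore] -/
private theorem tendsto_natCast_mul_add_two_atTop : Tendsto (fun l : ℕ ↦ (l : ℝ) * (l + 2)) atTop atTop :=
  tendsto_natCast_atTop_atTop.atTop_mul_atTop₀ (tendsto_natCast_atTop_atTop.atTop_add tendsto_const_nhds)

/-- The Dirichlet eigenvalues of `S³₊` tend to `+∞` along the cofinite filter. [cite: FreitasMaoSalavessa2025, §2.2] -/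
theorem tendsto_dirichletThreeHemisphere_cofinite_atTop :
    Tendsto (fun i : (Σ l : ℕ, Fin ((l + 1).choose 2)) ↦ (i.1 : ℝ) * (i.1 + 2)) cofinite atTop :=
  tendsto_sigma_fin_cofinite_atTop (μ := fun l : ℕ ↦ (l : ℝ) * (l + 2)) tendsto_natCast_mul_add_two_atTop

/-- The Neumann eigenvalues of `S³₊` tend to `+∞` along the cofinite filter. [cite: FreitasMaoSalavessa2025, §1.3, §2.2] -/
theorem tendsto_neumannThreeHemisphere_cofinite_atTop :
    Tendsto (fun i : (Σ l : ℕ, Fin ((l + 2).choose 2)) ↦ (i.1 : ℝ) * (i.1 + 2)) cofinite atTop :=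
  tendsto_sigma_fin_cofinite_atTop (μ := fun l : ℕ ↦ (l : ℝ) * (l + 2)) tendsto_natCast_mul_add_two_atTop

/-- `l(l+2) = 0 ↔ l = 0` on `ℕ`. [folklore] -/
private theorem natCast_mul_add_two_eq_zero_iff (l : ℕ) : (l : ℝ) * (l + 2) = 0 ↔ l = 0 := by
  constructor
  · intro h
    rcases mul_eq_zero.mp h with h | h
    · exact_mod_cast h
    · linarith [(l.cast_nonneg : (0 : ℝ) ≤ l)]
  · rintro rfl; simp

/-- The Dirichlet problem on `S³₊` has no zero mode (`binom(1,2) = 0`). [cite: FreitasMaoSalavessa2025, §2.2] -/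
theorem ncard_setOf_dirichletThreeHemisphere_eq_zero :
    {i : (Σ l : ℕ, Fin ((l + 1).choose 2)) | (i.1 : ℝ) * (i.1 + 2) = 0}.ncard = 0 := by
  rw [ncard_setOf_sigma_fin_eq (d := fun l ↦ (l + 1).choose 2) (μ := fun l : ℕ ↦ (l : ℝ) * (l + 2))
    natCast_mul_add_two_eq_zero_iff]
  rfl

/-- The Neumann problem on `S³₊` has exactly one zero mode, the constants (`binom(2,2) = 1`). [cite: FreitasMaoSalavessa2025,
§1.3, §2.2] -/
theorem ncard_setOf_neumannThreeHemisphere_eq_zero :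
    {i : (Σ l : ℕ, Fin ((l + 2).choose 2)) | (i.1 : ℝ) * (i.1 + 2) = 0}.ncard = 1 := by
  rw [ncard_setOf_sigma_fin_eq (d := fun l ↦ (l + 2).choose 2) (μ := fun l : ℕ ↦ (l : ℝ) * (l + 2))
    natCast_mul_add_two_eq_zero_iff]
  rfl

/-! ### §3 The boundary trace to all orders: `E(t) − ½∑_{j≤N} d_j t^{j−1} = O(t^N)`, `d_j = ∑_{a+b=j} (1/a!)·c_b`
(`d₀ = 1`, `d₁ = 5/6`, `d₂ = 19/60`) — the Cauchy product of `e^t` with the Euler–Maclaurin series of §1 -/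

/-- A real polynomial minus its truncation below degree `N+1` is `O(t^{N+1})` at `0`. [folklore] -/
private theorem isBigO_eval_sub_sum_coeff' (p : ℝ[X]) (N : ℕ) :
    (fun t : ℝ ↦ p.eval t - ∑ k ∈ Finset.range (N + 1), p.coeff k * t ^ k) =O[𝓝[>] 0]
      fun t : ℝ ↦ t ^ (N + 1) := by
  set Dp : ℝ[X] := p - ∑ k ∈ Finset.range (N + 1), C (p.coeff k) * X ^ k with hDp
  have hcoeff : ∀ d < N + 1, Dp.coeff d = 0 := by
    intro d hd
    simp only [hDp, coeff_sub, finsetSum_coeff, coeff_C_mul_X_pow]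
    rw [Finset.sum_ite_eq, if_pos (Finset.mem_range.mpr hd), sub_self]
  obtain ⟨r, hr⟩ := Polynomial.X_pow_dvd_iff.mpr hcoeff
  have hev : ∀ t : ℝ, p.eval t - ∑ k ∈ Finset.range (N + 1), p.coeff k * t ^ k = t ^ (N + 1) * r.eval t := by
    intro t
    have := congrArg (Polynomial.eval t) hr
    simp only [hDp, eval_sub, eval_finsetSum, eval_mul, eval_C, eval_pow, eval_X] at this
    rw [this]
  have hr1 : (fun t : ℝ ↦ r.eval t) =O[𝓝[>] 0] fun _ : ℝ ↦ (1 : ℝ) :=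
    ((r.continuous.tendsto 0).isBigO_one ℝ).mono nhdsWithin_le_nhds
  have h := (isBigO_refl (fun t : ℝ ↦ t ^ (N + 1)) (𝓝[>] (0 : ℝ))).mul hr1
  simp only [mul_one] at h
  exact h.congr' (Eventually.of_forall fun t ↦ (hev t).symm) EventuallyEq.rfl

/-- `e^t − ∑_{i≤M} tⁱ/i! = O(t^{M+1})` at `0⁺`. [folklore] -/
private theorem isBigO_exp_sub_sum' (M : ℕ) :
    (fun t : ℝ ↦ rexp t - ∑ i ∈ Finset.range (M + 1), 1 / (i.factorial : ℝ) * t ^ i) =O[𝓝[>] 0]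
      fun t : ℝ ↦ t ^ (M + 1) := by
  refine IsBigO.of_bound (((M + 2 : ℕ) : ℝ) / (((M + 1).factorial : ℝ) * ((M + 1 : ℕ) : ℝ))) ?_
  filter_upwards [Ioc_mem_nhdsGT (zero_lt_one' ℝ)] with t ht
  have hb := Real.exp_bound (x := t) (by rw [abs_of_pos ht.1]; exact ht.2) (Nat.succ_pos M)
  simp only [Nat.succ_eq_add_one, abs_of_pos ht.1] at hb
  have e : ∑ i ∈ Finset.range (M + 1), 1 / (i.factorial : ℝ) * t ^ i = ∑ i ∈ Finset.range (M + 1), t ^ i / (i.factorial : ℝ) :=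
    Finset.sum_congr rfl fun i _ ↦ by ring
  rw [Real.norm_eq_abs, Real.norm_of_nonneg (pow_nonneg ht.1.le _), e]
  refine hb.trans (le_of_eq ?_)
  push_cast
  ring

/-- **THE BOUNDARY TRACE OF `S³₊` TO ALL ORDERS: `E(t) − ½∑_{j≤N} d_j t^{j−1} = O(t^N)`**, `E(t) = e^t∑_{n≥0}n e^{−tn²} =
(Z_N − Z_D)(t)`, `d_j = ∑_{a+b=j}(1/a!)(−1)ᵇB_{2b}/b!` (`E = 1/(2t) + 5/12 + (19/120)t + ⋯`): unlike on `S²₊`, where the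
difference of the two traces is a theta function with a closed form up to `O(t^∞)`, on `S³₊` it is the divergent
Euler–Maclaurin series of §1. [cite: McKeanSinger1967, eq. (6) p. 45 (the boundary terms `±`); PathriaBeale2011, §6.5 (19)–(20)
(the method); DavisRabinowitz1984, Sect. 2.9 (2.9.14)] -/
theorem isBigO_threeHemisphere_boundaryTrace_sub (N : ℕ) :
    (fun t : ℝ ↦ rexp t * ∑' n : ℕ, (n : ℝ) * rexp (-(t * ((n : ℝ)) ^ 2)) -
      1 / 2 * ∑ j : Fin (N + 1), (∑ p ∈ Finset.HasAntidiagonal.antidiagonal (j : ℕ),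
          1 / (p.1.factorial : ℝ) * ((-1 : ℝ) ^ p.2 * (bernoulli (2 * p.2) : ℝ) / (p.2.factorial : ℝ))) * t ^ (((j : ℕ) : ℝ) - 1)) =O[𝓝[>] 0] fun t : ℝ ↦ t ^ (N : ℝ) := by
  set W : ℝ → ℝ := fun t ↦ ∑' n : ℕ, (n : ℝ) * rexp (-(t * ((n : ℝ)) ^ 2)) with hW
  set c : ℕ → ℝ := fun j ↦ (-1 : ℝ) ^ j * (bernoulli (2 * j) : ℝ) / (j.factorial : ℝ) with hc
  set cc : ℕ → ℝ := fun i ↦ 1 / (i.factorial : ℝ) with hcc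
  set d : ℕ → ℝ := fun k ↦ ∑ p ∈ Finset.HasAntidiagonal.antidiagonal k, cc p.1 * c p.2 with hd
  -- the two polynomial truncations
  set P : ℝ[X] := ∑ i ∈ Finset.range (N + 1 + 1), C (cc i) * X ^ i with hP
  set Q : ℝ[X] := ∑ j ∈ Finset.range (N + 1 + 1), C (c j) * X ^ j with hQ
  have hPev : ∀ t : ℝ, P.eval t = ∑ i ∈ Finset.range (N + 1 + 1), cc i * t ^ i := fun t ↦ by
    simp only [hP, eval_finsetSum, eval_mul, eval_C, eval_pow, eval_X]
  have hQev : ∀ t : ℝ, Q.eval t = ∑ j ∈ Finset.range (N + 1 + 1), c j * t ^ j := fun t ↦ by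
    simp only [hQ, eval_finsetSum, eval_mul, eval_C, eval_pow, eval_X]
  have hPc : ∀ i, P.coeff i = if i ∈ Finset.range (N + 1 + 1) then cc i else 0 := fun i ↦ by
    simp only [hP, finsetSum_coeff, coeff_C_mul_X_pow]
    rw [Finset.sum_ite_eq]
  have hQc : ∀ j, Q.coeff j = if j ∈ Finset.range (N + 1 + 1) then c j else 0 := fun j ↦ by
    simp only [hQ, finsetSum_coeff, coeff_C_mul_X_pow]
    rw [Finset.sum_ite_eq]
  have hPQc : ∀ k < N + 1, (P * Q).coeff k = d k := by
    intro k hk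
    rw [coeff_mul, hd]
    refine Finset.sum_congr rfl fun p hp ↦ ?_
    rw [Finset.HasAntidiagonal.mem_antidiagonal] at hp
    rw [hPc, hQc, if_pos (Finset.mem_range.mpr (by omega)), if_pos (Finset.mem_range.mpr (by omega))]
  -- (1) `e^t − P = O(t^{N+2})`, (2) `2tW − Q = O(t^{N+2})`
  have h1 : (fun t : ℝ ↦ rexp t - P.eval t) =O[𝓝[>] 0] fun t : ℝ ↦ t ^ (N + 1 + 1) :=
    (isBigO_exp_sub_sum' (N + 1)).congr' (Eventually.of_forall fun t ↦ by simp only [hPev, hcc]) EventuallyEq.rfl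
  have h2 : (fun t : ℝ ↦ 2 * t * W t - Q.eval t) =O[𝓝[>] 0] fun t : ℝ ↦ t ^ (N + 1 + 1) :=
    (isBigO_mul_tsum_nat_mul_exp_neg_mul_sq_sub (N + 1)).congr' (Eventually.of_forall fun t ↦ by
      simp only [hQev, hc, hW]) EventuallyEq.rfl
  -- bounded factors near `0⁺`
  have hE : (fun t : ℝ ↦ rexp t) =O[𝓝[>] 0] fun _ : ℝ ↦ (1 : ℝ) :=
    ((Real.continuous_exp.tendsto 0).isBigO_one ℝ).mono nhdsWithin_le_nhds
  have hQ1 : (fun t : ℝ ↦ Q.eval t) =O[𝓝[>] 0] fun _ : ℝ ↦ (1 : ℝ) :=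
    ((Q.continuous.tendsto 0).isBigO_one ℝ).mono nhdsWithin_le_nhds
  -- (3) `2t·E − PQ = O(t^{N+2})`
  have h3 : (fun t : ℝ ↦ 2 * t * (rexp t * W t) - (P * Q).eval t) =O[𝓝[>] 0] fun t : ℝ ↦ t ^ (N + 1 + 1) := by
    have h := (hE.mul h2).add (hQ1.mul h1)
    simp only [one_mul] at h
    refine h.congr' ?_ EventuallyEq.rfl
    filter_upwards with t
    rw [eval_mul]
    ring
  -- (4) `PQ − ∑_{k≤N} d_k t^k = O(t^{N+1})`
  have h4 : (fun t : ℝ ↦ (P * Q).eval t - ∑ k ∈ Finset.range (N + 1), d k * t ^ k) =O[𝓝[>] 0]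
      fun t : ℝ ↦ t ^ (N + 1) :=
    (isBigO_eval_sub_sum_coeff' (P * Q) N).congr' (Eventually.of_forall fun t ↦ by
      simp only
      exact congrArg (fun x : ℝ ↦ (P * Q).eval t - x)
        (Finset.sum_congr rfl fun k hk ↦ by rw [hPQc k (Finset.mem_range.mp hk)])) EventuallyEq.rfl
  -- (5) `2tE − ∑ d_k t^k = O(t^{N+1})`
  have h34 : (fun t : ℝ ↦ t ^ (N + 1 + 1)) =O[𝓝[>] 0] fun t : ℝ ↦ t ^ (N + 1) := by
    refine IsBigO.of_bound 1 ?_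
    filter_upwards [Ioc_mem_nhdsGT (zero_lt_one' ℝ)] with t ht
    rw [Real.norm_of_nonneg (pow_nonneg ht.1.le _), Real.norm_of_nonneg (pow_nonneg ht.1.le _), one_mul, pow_succ]
    exact mul_le_of_le_one_right (pow_nonneg ht.1.le _) ht.2
  have h5 : (fun t : ℝ ↦ 2 * t * (rexp t * W t) - ∑ k ∈ Finset.range (N + 1), d k * t ^ k) =O[𝓝[>] 0]
      fun t : ℝ ↦ t ^ (N + 1) := by
    have h := (h3.trans h34).add h4
    refine h.congr' ?_ EventuallyEq.rfl
    filter_upwards with t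
    ring
  -- (6) divide by `2t`
  have h6 : (fun t : ℝ ↦ (2 * t)⁻¹) =O[𝓝[>] 0] fun t : ℝ ↦ t⁻¹ := by
    refine IsBigO.of_bound 1 ?_
    filter_upwards [self_mem_nhdsWithin] with t (ht : 0 < t)
    rw [Real.norm_of_nonneg (by positivity), Real.norm_of_nonneg (by positivity), mul_inv, one_mul]
    exact mul_le_of_le_one_left (by positivity) (by norm_num)
  have h7 := h6.mul h5
  refine h7.congr' ?_ ?_
  · filter_upwards [self_mem_nhdsWithin] with t (ht : 0 < t)
    have h2t : (2 * t) ≠ 0 := by positivity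
    rw [mul_sub, ← mul_assoc, inv_mul_cancel₀ h2t, one_mul, Finset.mul_sum, Finset.mul_sum,
      ← Fin.sum_univ_eq_sum_range (fun k ↦ (2 * t)⁻¹ * (d k * t ^ k))]
    congr 1
    refine Finset.sum_congr rfl fun k _ ↦ ?_
    simp only [hd, hc, hcc]
    rw [Real.rpow_sub ht, Real.rpow_natCast, Real.rpow_one]
    field_simp
  · filter_upwards [self_mem_nhdsWithin] with t (ht : 0 < t)
    rw [Real.rpow_natCast, pow_succ, mul_comm (t ^ N), ← mul_assoc, inv_mul_cancel₀ ht.ne', one_mul]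

/-- `d₀ = 1`. [cite: McKeanSinger1967, eq. (6) p. 45] -/
theorem threeHemisphere_boundaryCoeff_zero :
    (∑ p ∈ Finset.HasAntidiagonal.antidiagonal 0,
      1 / (p.1.factorial : ℝ) * ((-1 : ℝ) ^ p.2 * (bernoulli (2 * p.2) : ℝ) / (p.2.factorial : ℝ))) = 1 := by
  rw [Finset.Nat.antidiagonal_zero, Finset.sum_singleton]
  simp [_root_.bernoulli_zero]

/-- `d₁ = 1 − 1/6 = 5/6`. [cite: McKeanSinger1967, eq. (6) p. 45] -/
theorem threeHemisphere_boundaryCoeff_one :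
    (∑ p ∈ Finset.HasAntidiagonal.antidiagonal 1,
      1 / (p.1.factorial : ℝ) * ((-1 : ℝ) ^ p.2 * (bernoulli (2 * p.2) : ℝ) / (p.2.factorial : ℝ))) = 5 / 6 := by
  rw [Finset.Nat.sum_antidiagonal_succ, Finset.Nat.antidiagonal_zero, Finset.sum_singleton]
  simp only [Nat.factorial_zero, Nat.cast_one, pow_zero, mul_zero, _root_.bernoulli_zero, Rat.cast_one, mul_one,
    Nat.factorial_one, pow_one, _root_.bernoulli_two, zero_add]
  push_cast
  norm_num

/-- `d₂ = 1/2 − 1/6 − 1/60 = 19/60`. [cite: McKeanSinger1967, eq. (6) p. 45] -/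
theorem threeHemisphere_boundaryCoeff_two :
    (∑ p ∈ Finset.HasAntidiagonal.antidiagonal 2,
      1 / (p.1.factorial : ℝ) * ((-1 : ℝ) ^ p.2 * (bernoulli (2 * p.2) : ℝ) / (p.2.factorial : ℝ))) = 19 / 60 := by
  rw [Finset.Nat.sum_antidiagonal_succ, Finset.Nat.sum_antidiagonal_succ, Finset.Nat.antidiagonal_zero,
    Finset.sum_singleton]
  simp only [Nat.factorial_zero, Nat.cast_one, pow_zero, mul_zero, _root_.bernoulli_zero, Rat.cast_one, mul_one,
    Nat.factorial_one, pow_one, _root_.bernoulli_two, zero_add, show 2 * 2 = 4 from rfl, bernoulli_four']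
  push_cast
  norm_num [Nat.factorial]

/-- **The printed first terms of the boundary trace: `E(t) = 1/(2t) + 5/12 + (19/120)t + O(t²)`.** [cite: McKeanSinger1967,
eq. (6) p. 45] -/
theorem isBigO_threeHemisphere_boundaryTrace_sub_three :
    (fun t : ℝ ↦ rexp t * ∑' n : ℕ, (n : ℝ) * rexp (-(t * ((n : ℝ)) ^ 2)) - (1 / (2 * t) + 5 / 12 + 19 / 120 * t)) =O[𝓝[>] 0]
      fun t : ℝ ↦ t ^ (2 : ℝ) := by
  refine (isBigO_threeHemisphere_boundaryTrace_sub 2).congr' ?_ EventuallyEq.rfl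
  filter_upwards [self_mem_nhdsWithin] with t (ht : 0 < t)
  rw [Fin.sum_univ_three]
  simp only [Fin.val_zero, Fin.val_one, Fin.val_two, Nat.cast_zero, Nat.cast_one, Nat.cast_ofNat,
    threeHemisphere_boundaryCoeff_zero, threeHemisphere_boundaryCoeff_one, threeHemisphere_boundaryCoeff_two, zero_sub,
    sub_self, Real.rpow_zero, Real.rpow_neg_one, show (2 : ℝ) - 1 = 1 by norm_num, Real.rpow_one]
  field_simp
  ring

/-! ### §4 The expansions of `Z_D`, `Z_N` on `S³₊` to all orders: half-integer powers `(√π/8)/k!·t^{k−3/2}` (half of `S³`),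
INTEGER powers `∓¼d_j t^{j−1}` (the boundary) — McKean–Singer's (6) in dimension `3` -/

/-- The common core: `½(Z_{S³} + εE) − [∑_{k≤N+1}((√π/8)/k!)t^{k−3/2} + (ε/4)∑_{j≤N} d_j t^{j−1}] = O(t^N)`, every real `ε`.
[cite: McKeanSinger1967, eq. (6) p. 45; Berard1986, Ch. VII nº2 Theorem (ii)] -/
private theorem isBigO_half_threeSphere_add_mul_E_sub (ε : ℝ) (N : ℕ) :
    (fun t : ℝ ↦ 1 / 2 * ((rexp t / 2 * ∑' n : ℤ, ((n : ℝ)) ^ 2 * rexp (-(t * ((n : ℝ)) ^ 2))) + ε * (rexp t * ∑' n : ℕ, (n : ℝ) * rexp (-(t * ((n : ℝ)) ^ 2)))) -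
      ∑ k : Fin (N + 2) ⊕ Fin (N + 1), Sum.elim (fun k : Fin (N + 2) ↦ π ^ (1 / 2 : ℝ) / 8 / ((k : ℕ).factorial : ℝ))
          (fun j : Fin (N + 1) ↦ ε * (1 / 4 : ℝ) * (∑ p ∈ Finset.HasAntidiagonal.antidiagonal (j : ℕ),
          1 / (p.1.factorial : ℝ) * ((-1 : ℝ) ^ p.2 * (bernoulli (2 * p.2) : ℝ) / (p.2.factorial : ℝ)))) k * t ^ (Sum.elim (fun k : Fin (N + 2) ↦ ((k : ℕ) : ℝ) - 3 / 2) (fun j : Fin (N + 1) ↦ ((j : ℕ) : ℝ) - 1) k)) =O[𝓝[>] 0] fun t : ℝ ↦ t ^ (N : ℝ) := by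
  have hS := isBigO_threeSphere_heatTrace_expansion (N + 1)
  have hS' : (fun t : ℝ ↦ t ^ ((((N + 1 : ℕ)) : ℝ) - 1 / 2)) =O[𝓝[>] 0] fun t : ℝ ↦ t ^ (N : ℝ) := by
    refine IsBigO.of_bound 1 ?_
    filter_upwards [Ioc_mem_nhdsGT (zero_lt_one' ℝ)] with t ht
    rw [Real.norm_of_nonneg (Real.rpow_nonneg ht.1.le _), Real.norm_of_nonneg (Real.rpow_nonneg ht.1.le _), one_mul]
    exact Real.rpow_le_rpow_of_exponent_ge ht.1 ht.2 (by push_cast; linarith)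
  have hE := isBigO_threeHemisphere_boundaryTrace_sub N
  have h := ((hS.trans hS').const_mul_left (1 / 2)).add (hE.const_mul_left (ε / 2))
  refine h.congr' ?_ EventuallyEq.rfl
  filter_upwards [self_mem_nhdsWithin] with t (ht : 0 < t)
  rw [(hasSum_threeSphere ht).tsum_eq, Fintype.sum_sum_type]
  simp only [Sum.elim_inl, Sum.elim_inr]
  have e1 : ∀ k : Fin (N + 2), π ^ (1 / 2 : ℝ) / 8 / ((k : ℕ).factorial : ℝ) * t ^ (((k : ℕ) : ℝ) - 3 / 2) =
      1 / 2 * (π ^ (1 / 2 : ℝ) / 4 / ((k : ℕ).factorial : ℝ) * t ^ (((k : ℕ) : ℝ) - 3 / 2)) := fun k ↦ by ring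
  have e2 : ∀ j : Fin (N + 1), ε * (1 / 4 : ℝ) * (∑ p ∈ Finset.HasAntidiagonal.antidiagonal (j : ℕ),
          1 / (p.1.factorial : ℝ) * ((-1 : ℝ) ^ p.2 * (bernoulli (2 * p.2) : ℝ) / (p.2.factorial : ℝ))) * t ^ (((j : ℕ) : ℝ) - 1) =
      ε / 2 * (1 / 2 * ((∑ p ∈ Finset.HasAntidiagonal.antidiagonal (j : ℕ),
          1 / (p.1.factorial : ℝ) * ((-1 : ℝ) ^ p.2 * (bernoulli (2 * p.2) : ℝ) / (p.2.factorial : ℝ))) * t ^ (((j : ℕ) : ℝ) - 1))) := fun j ↦ by ring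
  simp only [e1, e2, ← Finset.mul_sum]
  ring

/-- **THE DIRICHLET HEMISPHERE `S³₊` TO ALL ORDERS:
`Z_D(t) − [∑_{k≤N+1}((√π/8)/k!)t^{k−3/2} − ¼∑_{j≤N} d_j t^{j−1}] = O(t^N)`** on the index set `Fin (N+2) ⊕ Fin (N+1)`
(half-integer ⊕ INTEGER powers; `d_j = ∑_{a+b=j}(1/a!)(−1)ᵇB_{2b}/b!`): `Z_D = √π/(8t^{3/2}) − 1/(4t) + √π/(8√t) − 5/24 +
(√π/16)√t − (19/240)t + ⋯` — in odd dimension the interior invariants sit at the half-integers and the BOUNDARY invariants at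
the integers, where `Γ(s)ζ_D(s)` acquires the poles `s = 1, 0, −1, …` that the closed `S³` does not have.
[cite: McKeanSinger1967, eq. (6) p. 45; FreitasMaoSalavessa2025, §2.2; Berard1986, Ch. VII nº2 Theorem (ii)] -/
theorem isBigO_dirichletThreeHemisphere_heatTrace_expansion (N : ℕ) :
    (fun t : ℝ ↦ ∑' i : (Σ l : ℕ, Fin ((l + 1).choose 2)), rexp (-(t * ((i.1 : ℝ) * (i.1 + 2)))) -
      ∑ k : Fin (N + 2) ⊕ Fin (N + 1), Sum.elim (fun k : Fin (N + 2) ↦ π ^ (1 / 2 : ℝ) / 8 / ((k : ℕ).factorial : ℝ))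
          (fun j : Fin (N + 1) ↦ (-1) * (1 / 4 : ℝ) * (∑ p ∈ Finset.HasAntidiagonal.antidiagonal (j : ℕ),
          1 / (p.1.factorial : ℝ) * ((-1 : ℝ) ^ p.2 * (bernoulli (2 * p.2) : ℝ) / (p.2.factorial : ℝ)))) k * t ^ (Sum.elim (fun k : Fin (N + 2) ↦ ((k : ℕ) : ℝ) - 3 / 2) (fun j : Fin (N + 1) ↦ ((j : ℕ) : ℝ) - 1) k)) =O[𝓝[>] 0] fun t : ℝ ↦ t ^ (N : ℝ) := by
  refine (isBigO_half_threeSphere_add_mul_E_sub (-1) N).congr' ?_ EventuallyEq.rfl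
  filter_upwards [self_mem_nhdsWithin] with t (ht : 0 < t)
  rw [(hasSum_dirichletThreeHemisphere ht).tsum_eq]
  ring

/-- **THE NEUMANN HEMISPHERE `S³₊` TO ALL ORDERS:
`Z_N(t) − [∑_{k≤N+1}((√π/8)/k!)t^{k−3/2} + ¼∑_{j≤N} d_j t^{j−1}] = O(t^N)`**: `Z_N = √π/(8t^{3/2}) + 1/(4t) + √π/(8√t) +
5/24 + ⋯`. [cite: McKeanSinger1967, eq. (6) p. 45; FreitasMaoSalavessa2025, §1.3, §2.2; Berard1986, Ch. VII nº2 Theorem (ii)] -/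
theorem isBigO_neumannThreeHemisphere_heatTrace_expansion (N : ℕ) :
    (fun t : ℝ ↦ ∑' i : (Σ l : ℕ, Fin ((l + 2).choose 2)), rexp (-(t * ((i.1 : ℝ) * (i.1 + 2)))) -
      ∑ k : Fin (N + 2) ⊕ Fin (N + 1), Sum.elim (fun k : Fin (N + 2) ↦ π ^ (1 / 2 : ℝ) / 8 / ((k : ℕ).factorial : ℝ))
          (fun j : Fin (N + 1) ↦ 1 * (1 / 4 : ℝ) * (∑ p ∈ Finset.HasAntidiagonal.antidiagonal (j : ℕ),
          1 / (p.1.factorial : ℝ) * ((-1 : ℝ) ^ p.2 * (bernoulli (2 * p.2) : ℝ) / (p.2.factorial : ℝ)))) k * t ^ (Sum.elim (fun k : Fin (N + 2) ↦ ((k : ℕ) : ℝ) - 3 / 2) (fun j : Fin (N + 1) ↦ ((j : ℕ) : ℝ) - 1) k)) =O[𝓝[>] 0] fun t : ℝ ↦ t ^ (N : ℝ) := by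
  refine (isBigO_half_threeSphere_add_mul_E_sub 1 N).congr' ?_ EventuallyEq.rfl
  filter_upwards [self_mem_nhdsWithin] with t (ht : 0 < t)
  rw [(hasSum_neumannThreeHemisphere ht).tsum_eq]
  ring

/-- **`Z_N − Z_D − ½∑_{j≤N} d_j t^{j−1} = O(t^N)`**: the two problems differ by the boundary series only.
[cite: McKeanSinger1967, eq. (6) p. 45] -/
theorem isBigO_neumannThreeHemisphere_sub_dirichletThreeHemisphere (N : ℕ) :
    (fun t : ℝ ↦ ∑' i : (Σ l : ℕ, Fin ((l + 2).choose 2)), rexp (-(t * ((i.1 : ℝ) * (i.1 + 2)))) - ∑' i : (Σ l : ℕ, Fin ((l + 1).choose 2)), rexp (-(t * ((i.1 : ℝ) * (i.1 + 2)))) -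
      1 / 2 * ∑ j : Fin (N + 1), (∑ p ∈ Finset.HasAntidiagonal.antidiagonal (j : ℕ),
          1 / (p.1.factorial : ℝ) * ((-1 : ℝ) ^ p.2 * (bernoulli (2 * p.2) : ℝ) / (p.2.factorial : ℝ))) * t ^ (((j : ℕ) : ℝ) - 1)) =O[𝓝[>] 0] fun t : ℝ ↦ t ^ (N : ℝ) := by
  refine (isBigO_threeHemisphere_boundaryTrace_sub N).congr' ?_ EventuallyEq.rfl
  filter_upwards [self_mem_nhdsWithin] with t (ht : 0 < t)
  rw [tsum_neumannThreeHemisphere_sub_tsum_dirichletThreeHemisphere ht]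

/-- **McKEAN–SINGER (6) IN DIMENSION 3, AS PRINTED, FOR THE DIRICHLET HEMISPHERE:
`Z_D(t) = √π/(8t^{3/2}) − 1/(4t) + √π/(8√t) − 5/24 + O(√t)`** — "`(4πt)^{d/2}Z± = the volume of D ± ¼√(4πt) × the surface
area of B + (t/3) × ∫_D K ∓ … + O(t^{3/2})`" with `d = 3`, `vol S³₊ = π²`, `area B = vol S² = 4π`: `(4πt)^{3/2}·√π/(8t^{3/2}) =
π²` and `(4πt)^{3/2}·(1/(4t)) = ¼√(4πt)·4π`. [cite: McKeanSinger1967, eq. (6) p. 45 and §5 (2) p. 53; FreitasMaoSalavessa2025,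
§2.2] -/
theorem isBigO_dirichletThreeHemisphere_heatTrace_sub_mcKeanSinger :
    (fun t : ℝ ↦ ∑' i : (Σ l : ℕ, Fin ((l + 1).choose 2)), rexp (-(t * ((i.1 : ℝ) * (i.1 + 2)))) -
      (π ^ (1 / 2 : ℝ) / 8 * t ^ (-(3 / 2 : ℝ)) - 1 / (4 * t) + π ^ (1 / 2 : ℝ) / 8 * t ^ (-(1 / 2 : ℝ)) - 5 / 24))
      =O[𝓝[>] 0] fun t : ℝ ↦ t ^ (1 / 2 : ℝ) := by
  have h := isBigO_dirichletThreeHemisphere_heatTrace_expansion 1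
  have h1 : (fun t : ℝ ↦ t ^ ((1 : ℕ) : ℝ)) =O[𝓝[>] 0] fun t : ℝ ↦ t ^ (1 / 2 : ℝ) := by
    refine IsBigO.of_bound 1 ?_
    filter_upwards [Ioc_mem_nhdsGT (zero_lt_one' ℝ)] with t ht
    rw [Real.norm_of_nonneg (Real.rpow_nonneg ht.1.le _), Real.norm_of_nonneg (Real.rpow_nonneg ht.1.le _), one_mul,
      Nat.cast_one]
    exact Real.rpow_le_rpow_of_exponent_ge ht.1 ht.2 (by norm_num)
  have h2 : (fun t : ℝ ↦ π ^ (1 / 2 : ℝ) / 8 / 2 * t ^ (1 / 2 : ℝ)) =O[𝓝[>] 0] fun t : ℝ ↦ t ^ (1 / 2 : ℝ) :=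
    (isBigO_refl _ _).const_mul_left _
  refine ((h.trans h1).add h2).congr' ?_ EventuallyEq.rfl
  filter_upwards [self_mem_nhdsWithin] with t (ht : 0 < t)
  rw [Fintype.sum_sum_type, Fin.sum_univ_three, Fin.sum_univ_two]
  simp only [Sum.elim_inl, Sum.elim_inr, Fin.val_zero, Fin.val_one, Fin.val_two, Nat.cast_zero, Nat.cast_one,
    Nat.cast_ofNat, Nat.factorial_zero, Nat.factorial_one, Nat.factorial_two, threeHemisphere_boundaryCoeff_zero,
    threeHemisphere_boundaryCoeff_one, zero_sub, sub_self, Real.rpow_zero, Real.rpow_neg_one,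
    show (1 : ℝ) - 3 / 2 = -(1 / 2) by norm_num, show (2 : ℝ) - 3 / 2 = 1 / 2 by norm_num]
  field_simp
  ring

/-- **McKEAN–SINGER (6) IN DIMENSION 3, AS PRINTED, FOR THE NEUMANN HEMISPHERE:
`Z_N(t) = √π/(8t^{3/2}) + 1/(4t) + √π/(8√t) + 5/24 + O(√t)`.** [cite: McKeanSinger1967, eq. (6) p. 45; FreitasMaoSalavessa2025,
§1.3] -/
theorem isBigO_neumannThreeHemisphere_heatTrace_sub_mcKeanSinger :
    (fun t : ℝ ↦ ∑' i : (Σ l : ℕ, Fin ((l + 2).choose 2)), rexp (-(t * ((i.1 : ℝ) * (i.1 + 2)))) -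
      (π ^ (1 / 2 : ℝ) / 8 * t ^ (-(3 / 2 : ℝ)) + 1 / (4 * t) + π ^ (1 / 2 : ℝ) / 8 * t ^ (-(1 / 2 : ℝ)) + 5 / 24))
      =O[𝓝[>] 0] fun t : ℝ ↦ t ^ (1 / 2 : ℝ) := by
  have h := isBigO_neumannThreeHemisphere_heatTrace_expansion 1
  have h1 : (fun t : ℝ ↦ t ^ ((1 : ℕ) : ℝ)) =O[𝓝[>] 0] fun t : ℝ ↦ t ^ (1 / 2 : ℝ) := by
    refine IsBigO.of_bound 1 ?_
    filter_upwards [Ioc_mem_nhdsGT (zero_lt_one' ℝ)] with t ht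
    rw [Real.norm_of_nonneg (Real.rpow_nonneg ht.1.le _), Real.norm_of_nonneg (Real.rpow_nonneg ht.1.le _), one_mul,
      Nat.cast_one]
    exact Real.rpow_le_rpow_of_exponent_ge ht.1 ht.2 (by norm_num)
  have h2 : (fun t : ℝ ↦ π ^ (1 / 2 : ℝ) / 8 / 2 * t ^ (1 / 2 : ℝ)) =O[𝓝[>] 0] fun t : ℝ ↦ t ^ (1 / 2 : ℝ) :=
    (isBigO_refl _ _).const_mul_left _
  refine ((h.trans h1).add h2).congr' ?_ EventuallyEq.rfl
  filter_upwards [self_mem_nhdsWithin] with t (ht : 0 < t)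
  rw [Fintype.sum_sum_type, Fin.sum_univ_three, Fin.sum_univ_two]
  simp only [Sum.elim_inl, Sum.elim_inr, Fin.val_zero, Fin.val_one, Fin.val_two, Nat.cast_zero, Nat.cast_one,
    Nat.cast_ofNat, Nat.factorial_zero, Nat.factorial_one, Nat.factorial_two, threeHemisphere_boundaryCoeff_zero,
    threeHemisphere_boundaryCoeff_one, zero_sub, sub_self, Real.rpow_zero, Real.rpow_neg_one,
    show (1 : ℝ) - 3 / 2 = -(1 / 2) by norm_num, show (2 : ℝ) - 3 / 2 = 1 / 2 by norm_num]
  field_simp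
  ring

/-! ### §5 Consequences through the abstract heat-trace theory: Weyl `#{λ ≤ Λ}/Λ^{3/2} → 1/6`, `ζ_D(0) = −5/24`,
`ζ_N(0) = −19/24`, the INTEGER pole `s = 1` (residues `∓¼`), the pole `s = 3/2` (residue `¼`), `ζ_D` regular at `−j` -/

/-- Half-integer exponent bookkeeping: `k − 3/2 = x ↔ k = ⟨m, _⟩` when `x + 3/2 = m`. [folklore] -/
private theorem threeHemisphereHalfExponent_eq_iff (M : ℕ) {m : ℕ} (hm : m < M) (x : ℝ) (hx : x + 3 / 2 = m)
    (k : Fin M) : ((((k : ℕ) : ℝ) - 3 / 2) = x) = (k = ⟨m, hm⟩) := by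
  rw [Fin.ext_iff, sub_eq_iff_eq_add, hx]
  simp only [Nat.cast_inj]

/-- Integer exponent bookkeeping: `j − 1 = x ↔ j = ⟨m, _⟩` when `x + 1 = m`. [folklore] -/
private theorem threeHemisphereExponent_eq_iff (M : ℕ) {m : ℕ} (hm : m < M) (x : ℝ) (hx : x + 1 = m) (j : Fin M) :
    ((((j : ℕ) : ℝ) - 1) = x) = (j = ⟨m, hm⟩) := by
  rw [Fin.ext_iff, sub_eq_iff_eq_add, hx]
  simp only [Nat.cast_inj]

/-- `k − 3/2` is never an integer. [folklore] -/
private theorem natCast_sub_three_halves_ne_intCast (k : ℕ) (m : ℤ) : (k : ℝ) - 3 / 2 ≠ (m : ℝ) := by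
  intro h
  have h2 : ((2 * (k : ℤ) - 3 : ℤ) : ℝ) = ((2 * m : ℤ) : ℝ) := by push_cast; linarith
  have h3 := Int.cast_injective h2
  omega

/-- `k − 3/2 ≠ 0`. [folklore] -/
private theorem natCast_sub_three_halves_ne_zero (k : ℕ) : (k : ℝ) - 3 / 2 ≠ 0 := by
  simpa using natCast_sub_three_halves_ne_intCast k 0

/-- `k − 3/2 ≠ −1`. [folklore] -/
private theorem natCast_sub_three_halves_ne_neg_one (k : ℕ) : (k : ℝ) - 3 / 2 ≠ -1 := by
  simpa using natCast_sub_three_halves_ne_intCast k (-1)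

/-- `k − 3/2 ≠ j`. [folklore] -/
private theorem natCast_sub_three_halves_ne_natCast (k j : ℕ) : (k : ℝ) - 3 / 2 ≠ (j : ℝ) := by
  simpa using natCast_sub_three_halves_ne_intCast k j

/-- `j − 1 ≠ −3/2`. [folklore] -/
private theorem natCast_sub_one_ne_neg_three_halves (j : ℕ) : (j : ℝ) - 1 ≠ -(3 / 2) := by
  intro h
  exact natCast_sub_three_halves_ne_intCast j (-1) (by push_cast; linarith)

/-- `Γ(3/2 + 1) = (3/4)√π`. [folklore] -/
private theorem Gamma_five_halves : Real.Gamma ((3 / 2 : ℝ) + 1) = 3 / 4 * π ^ (1 / 2 : ℝ) := by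
  rw [Real.Gamma_add_one (by norm_num), show (3 / 2 : ℝ) = 1 / 2 + 1 by norm_num,
    Real.Gamma_add_one (by norm_num), Real.Gamma_one_half_eq, Real.sqrt_eq_rpow]
  ring

/-- **WEYL'S LAW FOR THE DIRICHLET HEMISPHERE `S³₊`: `#{λ ≤ Λ}/Λ^{3/2} → (√π/8)/Γ(5/2) = 1/6 = vol(S³₊)/(6π²)`.**
[cite: Berard1986, Ch. VII nº10 (ii) (11); McKeanSinger1967, eq. (6) p. 45; FreitasMaoSalavessa2025, §2.2] -/
theorem tendsto_ncard_dirichletThreeHemisphere_le_div_rpow :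
    Tendsto (fun Λ : ℝ ↦ (({i : (Σ l : ℕ, Fin ((l + 1).choose 2)) | ((i.1 : ℝ) * (i.1 + 2)) ≤ Λ}.ncard : ℕ) : ℝ) / Λ ^ (3 / 2 : ℝ)) atTop (𝓝 (1 / 6)) := by
  have hexp : (fun t : ℝ ↦ ∑' i : (Σ l : ℕ, Fin ((l + 1).choose 2)), rexp (-(((i.1 : ℝ) * (i.1 + 2)) * t)) -
      ∑ k : Fin (0 + 2) ⊕ Fin (0 + 1), Sum.elim (fun k : Fin (0 + 2) ↦ π ^ (1 / 2 : ℝ) / 8 / ((k : ℕ).factorial : ℝ))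
          (fun j : Fin (0 + 1) ↦ (-1) * (1 / 4 : ℝ) * (∑ p ∈ Finset.HasAntidiagonal.antidiagonal (j : ℕ),
          1 / (p.1.factorial : ℝ) * ((-1 : ℝ) ^ p.2 * (bernoulli (2 * p.2) : ℝ) / (p.2.factorial : ℝ)))) k *
        t ^ (Sum.elim (fun k : Fin (0 + 2) ↦ ((k : ℕ) : ℝ) - 3 / 2) (fun j : Fin (0 + 1) ↦ ((j : ℕ) : ℝ) - 1) k)) =O[𝓝[>] 0] fun t : ℝ ↦ t ^ (((0 : ℕ) : ℝ)) := by
    refine ((isBigO_dirichletThreeHemisphere_heatTrace_expansion 0).congr' ?_ EventuallyEq.rfl)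
    filter_upwards with t
    congr 1
    exact tsum_congr fun i ↦ by rw [mul_comm]
  have hsum : ∀ t : ℝ, 0 < t → Summable fun i : (Σ l : ℕ, Fin ((l + 1).choose 2)) ↦ rexp (-(((i.1 : ℝ) * (i.1 + 2)) * t)) :=
    fun t ht ↦ (summable_dirichletThreeHemisphere ht).congr fun i ↦ by rw [mul_comm]
  have h := tendsto_ncard_le_div_rpow_of_expansion (μ := fun i : (Σ l : ℕ, Fin ((l + 1).choose 2)) ↦ ((i.1 : ℝ) * (i.1 + 2))) (ρ := (3 / 2 : ℝ))
    (fun i ↦ by positivity) hsum hexp (fun k ↦ ?_) (by simp) (by norm_num)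
  swap
  · rcases k with k | j
    · simp only [Sum.elim_inl]
      linarith [((k : ℕ).cast_nonneg : (0 : ℝ) ≤ (k : ℕ))]
    · simp only [Sum.elim_inr]
      linarith [((j : ℕ).cast_nonneg : (0 : ℝ) ≤ (j : ℕ))]
  have h0 : 0 < 0 + 2 := by omega
  have e : (∑ k : Fin (0 + 2) ⊕ Fin (0 + 1), if Sum.elim (fun k : Fin (0 + 2) ↦ ((k : ℕ) : ℝ) - 3 / 2) (fun j : Fin (0 + 1) ↦ ((j : ℕ) : ℝ) - 1) k = -(3 / 2 : ℝ) then
      Sum.elim (fun k : Fin (0 + 2) ↦ π ^ (1 / 2 : ℝ) / 8 / ((k : ℕ).factorial : ℝ))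
          (fun j : Fin (0 + 1) ↦ (-1) * (1 / 4 : ℝ) * (∑ p ∈ Finset.HasAntidiagonal.antidiagonal (j : ℕ),
          1 / (p.1.factorial : ℝ) * ((-1 : ℝ) ^ p.2 * (bernoulli (2 * p.2) : ℝ) / (p.2.factorial : ℝ)))) k else 0) / Real.Gamma ((3 / 2 : ℝ) + 1) = 1 / 6 := by
    rw [Gamma_five_halves, Fintype.sum_sum_type]
    simp only [Sum.elim_inl, Sum.elim_inr, threeHemisphereHalfExponent_eq_iff (0 + 2) h0 (-(3 / 2)) (by norm_num),
      Finset.sum_ite_eq', Finset.mem_univ, if_true, natCast_sub_one_ne_neg_three_halves, if_false, Finset.sum_const_zero,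
      add_zero, Nat.factorial_zero, Nat.cast_one, div_one]
    have hπ : 0 < π ^ (1 / 2 : ℝ) := Real.rpow_pos_of_pos Real.pi_pos _
    field_simp
    norm_num
  rw [e] at h
  exact h

/-- **`ζ_D(0) = −¼d₁ − dim ker Δ_D = −5/24 − 0`** — at `s = 0` only the INTEGER-exponent (boundary) term `t⁰` of the expansion counts.
[cite: Gilkey1995, §1.10 Lemma 1.10.1; McKeanSinger1967, eq. (6) p. 45] -/
theorem tendsto_dirichletThreeHemisphereZeta_continuation_nhdsNE_zero (N : ℕ) (hN : N ≠ 0) :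
    Tendsto (fun s : ℂ ↦ (Complex.Gamma s)⁻¹ *
        (∑ k : Fin (N + 2) ⊕ Fin (N + 1), (((Sum.elim (fun k : Fin (N + 2) ↦ π ^ (1 / 2 : ℝ) / 8 / ((k : ℕ).factorial : ℝ))
          (fun j : Fin (N + 1) ↦ (-1) * (1 / 4 : ℝ) * (∑ p ∈ Finset.HasAntidiagonal.antidiagonal (j : ℕ),
          1 / (p.1.factorial : ℝ) * ((-1 : ℝ) ^ p.2 * (bernoulli (2 * p.2) : ℝ) / (p.2.factorial : ℝ)))) k : ℝ)) : ℂ) / (s + ((Sum.elim (fun k : Fin (N + 2) ↦ ((k : ℕ) : ℝ) - 3 / 2) (fun j : Fin (N + 1) ↦ ((j : ℕ) : ℝ) - 1) k) : ℝ)) -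
          ({i : (Σ l : ℕ, Fin ((l + 1).choose 2)) | ((i.1 : ℝ) * (i.1 + 2)) = 0}.ncard : ℂ) / s +
        mellin (fun t : ℝ ↦ ((∑' i : {i : (Σ l : ℕ, Fin ((l + 1).choose 2)) | ((i.1 : ℝ) * (i.1 + 2)) ≠ 0},
            rexp (-(t * ((((i : (Σ l : ℕ, Fin ((l + 1).choose 2)))).1 : ℝ) * (((i : (Σ l : ℕ, Fin ((l + 1).choose 2)))).1 + 2)))) : ℝ) : ℂ) -
          (Ioc 0 1).indicator (fun t : ℝ ↦ ((∑ k : Fin (N + 2) ⊕ Fin (N + 1), Sum.elim (fun k : Fin (N + 2) ↦ π ^ (1 / 2 : ℝ) / 8 / ((k : ℕ).factorial : ℝ))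
          (fun j : Fin (N + 1) ↦ (-1) * (1 / 4 : ℝ) * (∑ p ∈ Finset.HasAntidiagonal.antidiagonal (j : ℕ),
          1 / (p.1.factorial : ℝ) * ((-1 : ℝ) ^ p.2 * (bernoulli (2 * p.2) : ℝ) / (p.2.factorial : ℝ)))) k *
            t ^ (Sum.elim (fun k : Fin (N + 2) ↦ ((k : ℕ) : ℝ) - 3 / 2) (fun j : Fin (N + 1) ↦ ((j : ℕ) : ℝ) - 1) k) : ℝ) : ℂ) -
            ({i : (Σ l : ℕ, Fin ((l + 1).choose 2)) | ((i.1 : ℝ) * (i.1 + 2)) = 0}.ncard : ℂ)) t) s))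
      (𝓝[≠] 0) (𝓝 (-(5 / 24))) := by
  have hβ : (0 : ℝ) < (N : ℝ) := by exact_mod_cast Nat.pos_of_ne_zero hN
  have h := tendsto_continuation_nhdsNE_zero (μ := fun i : (Σ l : ℕ, Fin ((l + 1).choose 2)) ↦ ((i.1 : ℝ) * (i.1 + 2)))
    (fun i ↦ by positivity) tendsto_dirichletThreeHemisphere_cofinite_atTop (fun t ht ↦ summable_dirichletThreeHemisphere ht)
    (isBigO_dirichletThreeHemisphere_heatTrace_expansion N) hβ
  have h1N : 1 < N + 1 := by omega
  have e : ((∑ k : Fin (N + 2) ⊕ Fin (N + 1), if Sum.elim (fun k : Fin (N + 2) ↦ ((k : ℕ) : ℝ) - 3 / 2) (fun j : Fin (N + 1) ↦ ((j : ℕ) : ℝ) - 1) k = 0 then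
      (((Sum.elim (fun k : Fin (N + 2) ↦ π ^ (1 / 2 : ℝ) / 8 / ((k : ℕ).factorial : ℝ))
          (fun j : Fin (N + 1) ↦ (-1) * (1 / 4 : ℝ) * (∑ p ∈ Finset.HasAntidiagonal.antidiagonal (j : ℕ),
          1 / (p.1.factorial : ℝ) * ((-1 : ℝ) ^ p.2 * (bernoulli (2 * p.2) : ℝ) / (p.2.factorial : ℝ)))) k : ℝ)) : ℂ) else 0) -
      ({i : (Σ l : ℕ, Fin ((l + 1).choose 2)) | ((i.1 : ℝ) * (i.1 + 2)) = 0}.ncard : ℂ)) = (-(5 / 24)) := by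
    rw [Fintype.sum_sum_type]
    simp only [Sum.elim_inl, Sum.elim_inr, natCast_sub_three_halves_ne_zero, if_false, Finset.sum_const_zero, zero_add,
      threeHemisphereExponent_eq_iff (N + 1) h1N 0 (by norm_num), Finset.sum_ite_eq', Finset.mem_univ, if_true,
      ncard_setOf_dirichletThreeHemisphere_eq_zero, threeHemisphere_boundaryCoeff_one]
    push_cast
    norm_num
  rw [e] at h
  exact h

/-- **THE INTEGER POLE: `Res_{s=1} ζ = Γ(1)^{−1}·(−¼d₀) = −¼`** — the closed `S³` has poles only at the
half-integers `3/2 − j`; the boundary of `S³₊` adds `s = 1` (and `0, −1, …` inside `Γ(s)ζ(s)`). [cite: Gilkey1995, §1.10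
Lemma 1.10.1; McKeanSinger1967, eq. (6) p. 45] -/
theorem tendsto_sub_one_mul_dirichletThreeHemisphereZeta_continuation (N : ℕ) :
    Tendsto (fun s : ℂ ↦ (s - ((1 : ℝ) : ℂ)) * ((Complex.Gamma s)⁻¹ *
        (∑ k : Fin (N + 2) ⊕ Fin (N + 1), (((Sum.elim (fun k : Fin (N + 2) ↦ π ^ (1 / 2 : ℝ) / 8 / ((k : ℕ).factorial : ℝ))
          (fun j : Fin (N + 1) ↦ (-1) * (1 / 4 : ℝ) * (∑ p ∈ Finset.HasAntidiagonal.antidiagonal (j : ℕ),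
          1 / (p.1.factorial : ℝ) * ((-1 : ℝ) ^ p.2 * (bernoulli (2 * p.2) : ℝ) / (p.2.factorial : ℝ)))) k : ℝ)) : ℂ) / (s + ((Sum.elim (fun k : Fin (N + 2) ↦ ((k : ℕ) : ℝ) - 3 / 2) (fun j : Fin (N + 1) ↦ ((j : ℕ) : ℝ) - 1) k) : ℝ)) -
          ({i : (Σ l : ℕ, Fin ((l + 1).choose 2)) | ((i.1 : ℝ) * (i.1 + 2)) = 0}.ncard : ℂ) / s +
        mellin (fun t : ℝ ↦ ((∑' i : {i : (Σ l : ℕ, Fin ((l + 1).choose 2)) | ((i.1 : ℝ) * (i.1 + 2)) ≠ 0},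
            rexp (-(t * ((((i : (Σ l : ℕ, Fin ((l + 1).choose 2)))).1 : ℝ) * (((i : (Σ l : ℕ, Fin ((l + 1).choose 2)))).1 + 2)))) : ℝ) : ℂ) -
          (Ioc 0 1).indicator (fun t : ℝ ↦ ((∑ k : Fin (N + 2) ⊕ Fin (N + 1), Sum.elim (fun k : Fin (N + 2) ↦ π ^ (1 / 2 : ℝ) / 8 / ((k : ℕ).factorial : ℝ))
          (fun j : Fin (N + 1) ↦ (-1) * (1 / 4 : ℝ) * (∑ p ∈ Finset.HasAntidiagonal.antidiagonal (j : ℕ),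
          1 / (p.1.factorial : ℝ) * ((-1 : ℝ) ^ p.2 * (bernoulli (2 * p.2) : ℝ) / (p.2.factorial : ℝ)))) k *
            t ^ (Sum.elim (fun k : Fin (N + 2) ↦ ((k : ℕ) : ℝ) - 3 / 2) (fun j : Fin (N + 1) ↦ ((j : ℕ) : ℝ) - 1) k) : ℝ) : ℂ) -
            ({i : (Σ l : ℕ, Fin ((l + 1).choose 2)) | ((i.1 : ℝ) * (i.1 + 2)) = 0}.ncard : ℂ)) t) s)))
      (𝓝[≠] ((1 : ℝ) : ℂ)) (𝓝 (-(1 / 4))) := by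
  have hs₀ : -(N : ℝ) < 1 := by linarith [(N.cast_nonneg : (0 : ℝ) ≤ N)]
  have h := tendsto_sub_mul_continuation_nhdsNE (μ := fun i : (Σ l : ℕ, Fin ((l + 1).choose 2)) ↦ ((i.1 : ℝ) * (i.1 + 2)))
    (fun i ↦ by positivity) tendsto_dirichletThreeHemisphere_cofinite_atTop (fun t ht ↦ summable_dirichletThreeHemisphere ht)
    (isBigO_dirichletThreeHemisphere_heatTrace_expansion N) hs₀
  have h0N : 0 < N + 1 := by omega
  have e : ((Complex.Gamma ((1 : ℝ) : ℂ))⁻¹ *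
      ((∑ k : Fin (N + 2) ⊕ Fin (N + 1), if Sum.elim (fun k : Fin (N + 2) ↦ ((k : ℕ) : ℝ) - 3 / 2) (fun j : Fin (N + 1) ↦ ((j : ℕ) : ℝ) - 1) k = -(1 : ℝ) then
        (((Sum.elim (fun k : Fin (N + 2) ↦ π ^ (1 / 2 : ℝ) / 8 / ((k : ℕ).factorial : ℝ))
          (fun j : Fin (N + 1) ↦ (-1) * (1 / 4 : ℝ) * (∑ p ∈ Finset.HasAntidiagonal.antidiagonal (j : ℕ),
          1 / (p.1.factorial : ℝ) * ((-1 : ℝ) ^ p.2 * (bernoulli (2 * p.2) : ℝ) / (p.2.factorial : ℝ)))) k : ℝ)) : ℂ) else 0) -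
        if (1 : ℝ) = 0 then ({i : (Σ l : ℕ, Fin ((l + 1).choose 2)) | ((i.1 : ℝ) * (i.1 + 2)) = 0}.ncard : ℂ) else 0)) = (-(1 / 4)) := by
    rw [Fintype.sum_sum_type]
    simp only [Sum.elim_inl, Sum.elim_inr, natCast_sub_three_halves_ne_neg_one, if_false, Finset.sum_const_zero, zero_add,
      threeHemisphereExponent_eq_iff (N + 1) h0N (-1) (by norm_num), Finset.sum_ite_eq', Finset.mem_univ, if_true,
      one_ne_zero, sub_zero, threeHemisphere_boundaryCoeff_zero, Complex.ofReal_one, Complex.Gamma_one, inv_one, one_mul]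
    push_cast
    ring
  rw [e] at h
  exact h

/-- **WEYL'S LAW FOR THE NEUMANN HEMISPHERE `S³₊`: `#{λ ≤ Λ}/Λ^{3/2} → (√π/8)/Γ(5/2) = 1/6 = vol(S³₊)/(6π²)`.**
[cite: Berard1986, Ch. VII nº10 (ii) (11); McKeanSinger1967, eq. (6) p. 45; FreitasMaoSalavessa2025, §1.3] -/
theorem tendsto_ncard_neumannThreeHemisphere_le_div_rpow :
    Tendsto (fun Λ : ℝ ↦ (({i : (Σ l : ℕ, Fin ((l + 2).choose 2)) | ((i.1 : ℝ) * (i.1 + 2)) ≤ Λ}.ncard : ℕ) : ℝ) / Λ ^ (3 / 2 : ℝ)) atTop (𝓝 (1 / 6)) := by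
  have hexp : (fun t : ℝ ↦ ∑' i : (Σ l : ℕ, Fin ((l + 2).choose 2)), rexp (-(((i.1 : ℝ) * (i.1 + 2)) * t)) -
      ∑ k : Fin (0 + 2) ⊕ Fin (0 + 1), Sum.elim (fun k : Fin (0 + 2) ↦ π ^ (1 / 2 : ℝ) / 8 / ((k : ℕ).factorial : ℝ))
          (fun j : Fin (0 + 1) ↦ 1 * (1 / 4 : ℝ) * (∑ p ∈ Finset.HasAntidiagonal.antidiagonal (j : ℕ),
          1 / (p.1.factorial : ℝ) * ((-1 : ℝ) ^ p.2 * (bernoulli (2 * p.2) : ℝ) / (p.2.factorial : ℝ)))) k *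
        t ^ (Sum.elim (fun k : Fin (0 + 2) ↦ ((k : ℕ) : ℝ) - 3 / 2) (fun j : Fin (0 + 1) ↦ ((j : ℕ) : ℝ) - 1) k)) =O[𝓝[>] 0] fun t : ℝ ↦ t ^ (((0 : ℕ) : ℝ)) := by
    refine ((isBigO_neumannThreeHemisphere_heatTrace_expansion 0).congr' ?_ EventuallyEq.rfl)
    filter_upwards with t
    congr 1
    exact tsum_congr fun i ↦ by rw [mul_comm]
  have hsum : ∀ t : ℝ, 0 < t → Summable fun i : (Σ l : ℕ, Fin ((l + 2).choose 2)) ↦ rexp (-(((i.1 : ℝ) * (i.1 + 2)) * t)) :=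
    fun t ht ↦ (summable_neumannThreeHemisphere ht).congr fun i ↦ by rw [mul_comm]
  have h := tendsto_ncard_le_div_rpow_of_expansion (μ := fun i : (Σ l : ℕ, Fin ((l + 2).choose 2)) ↦ ((i.1 : ℝ) * (i.1 + 2))) (ρ := (3 / 2 : ℝ))
    (fun i ↦ by positivity) hsum hexp (fun k ↦ ?_) (by simp) (by norm_num)
  swap
  · rcases k with k | j
    · simp only [Sum.elim_inl]
      linarith [((k : ℕ).cast_nonneg : (0 : ℝ) ≤ (k : ℕ))]
    · simp only [Sum.elim_inr]
      linarith [((j : ℕ).cast_nonneg : (0 : ℝ) ≤ (j : ℕ))]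
  have h0 : 0 < 0 + 2 := by omega
  have e : (∑ k : Fin (0 + 2) ⊕ Fin (0 + 1), if Sum.elim (fun k : Fin (0 + 2) ↦ ((k : ℕ) : ℝ) - 3 / 2) (fun j : Fin (0 + 1) ↦ ((j : ℕ) : ℝ) - 1) k = -(3 / 2 : ℝ) then
      Sum.elim (fun k : Fin (0 + 2) ↦ π ^ (1 / 2 : ℝ) / 8 / ((k : ℕ).factorial : ℝ))
          (fun j : Fin (0 + 1) ↦ 1 * (1 / 4 : ℝ) * (∑ p ∈ Finset.HasAntidiagonal.antidiagonal (j : ℕ),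
          1 / (p.1.factorial : ℝ) * ((-1 : ℝ) ^ p.2 * (bernoulli (2 * p.2) : ℝ) / (p.2.factorial : ℝ)))) k else 0) / Real.Gamma ((3 / 2 : ℝ) + 1) = 1 / 6 := by
    rw [Gamma_five_halves, Fintype.sum_sum_type]
    simp only [Sum.elim_inl, Sum.elim_inr, threeHemisphereHalfExponent_eq_iff (0 + 2) h0 (-(3 / 2)) (by norm_num),
      Finset.sum_ite_eq', Finset.mem_univ, if_true, natCast_sub_one_ne_neg_three_halves, if_false, Finset.sum_const_zero,
      add_zero, Nat.factorial_zero, Nat.cast_one, div_one]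
    have hπ : 0 < π ^ (1 / 2 : ℝ) := Real.rpow_pos_of_pos Real.pi_pos _
    field_simp
    norm_num
  rw [e] at h
  exact h

/-- **`ζ_N(0) = +¼d₁ − dim ker Δ_N = 5/24 − 1 = −19/24`** — at `s = 0` only the INTEGER-exponent (boundary) term `t⁰` of the expansion counts.
[cite: Gilkey1995, §1.10 Lemma 1.10.1; McKeanSinger1967, eq. (6) p. 45] -/
theorem tendsto_neumannThreeHemisphereZeta_continuation_nhdsNE_zero (N : ℕ) (hN : N ≠ 0) :
    Tendsto (fun s : ℂ ↦ (Complex.Gamma s)⁻¹ *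
        (∑ k : Fin (N + 2) ⊕ Fin (N + 1), (((Sum.elim (fun k : Fin (N + 2) ↦ π ^ (1 / 2 : ℝ) / 8 / ((k : ℕ).factorial : ℝ))
          (fun j : Fin (N + 1) ↦ 1 * (1 / 4 : ℝ) * (∑ p ∈ Finset.HasAntidiagonal.antidiagonal (j : ℕ),
          1 / (p.1.factorial : ℝ) * ((-1 : ℝ) ^ p.2 * (bernoulli (2 * p.2) : ℝ) / (p.2.factorial : ℝ)))) k : ℝ)) : ℂ) / (s + ((Sum.elim (fun k : Fin (N + 2) ↦ ((k : ℕ) : ℝ) - 3 / 2) (fun j : Fin (N + 1) ↦ ((j : ℕ) : ℝ) - 1) k) : ℝ)) -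
          ({i : (Σ l : ℕ, Fin ((l + 2).choose 2)) | ((i.1 : ℝ) * (i.1 + 2)) = 0}.ncard : ℂ) / s +
        mellin (fun t : ℝ ↦ ((∑' i : {i : (Σ l : ℕ, Fin ((l + 2).choose 2)) | ((i.1 : ℝ) * (i.1 + 2)) ≠ 0},
            rexp (-(t * ((((i : (Σ l : ℕ, Fin ((l + 2).choose 2)))).1 : ℝ) * (((i : (Σ l : ℕ, Fin ((l + 2).choose 2)))).1 + 2)))) : ℝ) : ℂ) -
          (Ioc 0 1).indicator (fun t : ℝ ↦ ((∑ k : Fin (N + 2) ⊕ Fin (N + 1), Sum.elim (fun k : Fin (N + 2) ↦ π ^ (1 / 2 : ℝ) / 8 / ((k : ℕ).factorial : ℝ))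
          (fun j : Fin (N + 1) ↦ 1 * (1 / 4 : ℝ) * (∑ p ∈ Finset.HasAntidiagonal.antidiagonal (j : ℕ),
          1 / (p.1.factorial : ℝ) * ((-1 : ℝ) ^ p.2 * (bernoulli (2 * p.2) : ℝ) / (p.2.factorial : ℝ)))) k *
            t ^ (Sum.elim (fun k : Fin (N + 2) ↦ ((k : ℕ) : ℝ) - 3 / 2) (fun j : Fin (N + 1) ↦ ((j : ℕ) : ℝ) - 1) k) : ℝ) : ℂ) -
            ({i : (Σ l : ℕ, Fin ((l + 2).choose 2)) | ((i.1 : ℝ) * (i.1 + 2)) = 0}.ncard : ℂ)) t) s))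
      (𝓝[≠] 0) (𝓝 (-(19 / 24))) := by
  have hβ : (0 : ℝ) < (N : ℝ) := by exact_mod_cast Nat.pos_of_ne_zero hN
  have h := tendsto_continuation_nhdsNE_zero (μ := fun i : (Σ l : ℕ, Fin ((l + 2).choose 2)) ↦ ((i.1 : ℝ) * (i.1 + 2)))
    (fun i ↦ by positivity) tendsto_neumannThreeHemisphere_cofinite_atTop (fun t ht ↦ summable_neumannThreeHemisphere ht)
    (isBigO_neumannThreeHemisphere_heatTrace_expansion N) hβ
  have h1N : 1 < N + 1 := by omega
  have e : ((∑ k : Fin (N + 2) ⊕ Fin (N + 1), if Sum.elim (fun k : Fin (N + 2) ↦ ((k : ℕ) : ℝ) - 3 / 2) (fun j : Fin (N + 1) ↦ ((j : ℕ) : ℝ) - 1) k = 0 then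
      (((Sum.elim (fun k : Fin (N + 2) ↦ π ^ (1 / 2 : ℝ) / 8 / ((k : ℕ).factorial : ℝ))
          (fun j : Fin (N + 1) ↦ 1 * (1 / 4 : ℝ) * (∑ p ∈ Finset.HasAntidiagonal.antidiagonal (j : ℕ),
          1 / (p.1.factorial : ℝ) * ((-1 : ℝ) ^ p.2 * (bernoulli (2 * p.2) : ℝ) / (p.2.factorial : ℝ)))) k : ℝ)) : ℂ) else 0) -
      ({i : (Σ l : ℕ, Fin ((l + 2).choose 2)) | ((i.1 : ℝ) * (i.1 + 2)) = 0}.ncard : ℂ)) = (-(19 / 24)) := by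
    rw [Fintype.sum_sum_type]
    simp only [Sum.elim_inl, Sum.elim_inr, natCast_sub_three_halves_ne_zero, if_false, Finset.sum_const_zero, zero_add,
      threeHemisphereExponent_eq_iff (N + 1) h1N 0 (by norm_num), Finset.sum_ite_eq', Finset.mem_univ, if_true,
      ncard_setOf_neumannThreeHemisphere_eq_zero, threeHemisphere_boundaryCoeff_one]
    push_cast
    norm_num
  rw [e] at h
  exact h

/-- **THE INTEGER POLE: `Res_{s=1} ζ = Γ(1)^{−1}·(+¼d₀) = +¼`** — the closed `S³` has poles only at the
half-integers `3/2 − j`; the boundary of `S³₊` adds `s = 1` (and `0, −1, …` inside `Γ(s)ζ(s)`). [cite: Gilkey1995, §1.10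
Lemma 1.10.1; McKeanSinger1967, eq. (6) p. 45] -/
theorem tendsto_sub_one_mul_neumannThreeHemisphereZeta_continuation (N : ℕ) :
    Tendsto (fun s : ℂ ↦ (s - ((1 : ℝ) : ℂ)) * ((Complex.Gamma s)⁻¹ *
        (∑ k : Fin (N + 2) ⊕ Fin (N + 1), (((Sum.elim (fun k : Fin (N + 2) ↦ π ^ (1 / 2 : ℝ) / 8 / ((k : ℕ).factorial : ℝ))
          (fun j : Fin (N + 1) ↦ 1 * (1 / 4 : ℝ) * (∑ p ∈ Finset.HasAntidiagonal.antidiagonal (j : ℕ),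
          1 / (p.1.factorial : ℝ) * ((-1 : ℝ) ^ p.2 * (bernoulli (2 * p.2) : ℝ) / (p.2.factorial : ℝ)))) k : ℝ)) : ℂ) / (s + ((Sum.elim (fun k : Fin (N + 2) ↦ ((k : ℕ) : ℝ) - 3 / 2) (fun j : Fin (N + 1) ↦ ((j : ℕ) : ℝ) - 1) k) : ℝ)) -
          ({i : (Σ l : ℕ, Fin ((l + 2).choose 2)) | ((i.1 : ℝ) * (i.1 + 2)) = 0}.ncard : ℂ) / s +
        mellin (fun t : ℝ ↦ ((∑' i : {i : (Σ l : ℕ, Fin ((l + 2).choose 2)) | ((i.1 : ℝ) * (i.1 + 2)) ≠ 0},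
            rexp (-(t * ((((i : (Σ l : ℕ, Fin ((l + 2).choose 2)))).1 : ℝ) * (((i : (Σ l : ℕ, Fin ((l + 2).choose 2)))).1 + 2)))) : ℝ) : ℂ) -
          (Ioc 0 1).indicator (fun t : ℝ ↦ ((∑ k : Fin (N + 2) ⊕ Fin (N + 1), Sum.elim (fun k : Fin (N + 2) ↦ π ^ (1 / 2 : ℝ) / 8 / ((k : ℕ).factorial : ℝ))
          (fun j : Fin (N + 1) ↦ 1 * (1 / 4 : ℝ) * (∑ p ∈ Finset.HasAntidiagonal.antidiagonal (j : ℕ),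
          1 / (p.1.factorial : ℝ) * ((-1 : ℝ) ^ p.2 * (bernoulli (2 * p.2) : ℝ) / (p.2.factorial : ℝ)))) k *
            t ^ (Sum.elim (fun k : Fin (N + 2) ↦ ((k : ℕ) : ℝ) - 3 / 2) (fun j : Fin (N + 1) ↦ ((j : ℕ) : ℝ) - 1) k) : ℝ) : ℂ) -
            ({i : (Σ l : ℕ, Fin ((l + 2).choose 2)) | ((i.1 : ℝ) * (i.1 + 2)) = 0}.ncard : ℂ)) t) s)))
      (𝓝[≠] ((1 : ℝ) : ℂ)) (𝓝 (1 / 4)) := by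
  have hs₀ : -(N : ℝ) < 1 := by linarith [(N.cast_nonneg : (0 : ℝ) ≤ N)]
  have h := tendsto_sub_mul_continuation_nhdsNE (μ := fun i : (Σ l : ℕ, Fin ((l + 2).choose 2)) ↦ ((i.1 : ℝ) * (i.1 + 2)))
    (fun i ↦ by positivity) tendsto_neumannThreeHemisphere_cofinite_atTop (fun t ht ↦ summable_neumannThreeHemisphere ht)
    (isBigO_neumannThreeHemisphere_heatTrace_expansion N) hs₀
  have h0N : 0 < N + 1 := by omega
  have e : ((Complex.Gamma ((1 : ℝ) : ℂ))⁻¹ *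
      ((∑ k : Fin (N + 2) ⊕ Fin (N + 1), if Sum.elim (fun k : Fin (N + 2) ↦ ((k : ℕ) : ℝ) - 3 / 2) (fun j : Fin (N + 1) ↦ ((j : ℕ) : ℝ) - 1) k = -(1 : ℝ) then
        (((Sum.elim (fun k : Fin (N + 2) ↦ π ^ (1 / 2 : ℝ) / 8 / ((k : ℕ).factorial : ℝ))
          (fun j : Fin (N + 1) ↦ 1 * (1 / 4 : ℝ) * (∑ p ∈ Finset.HasAntidiagonal.antidiagonal (j : ℕ),
          1 / (p.1.factorial : ℝ) * ((-1 : ℝ) ^ p.2 * (bernoulli (2 * p.2) : ℝ) / (p.2.factorial : ℝ)))) k : ℝ)) : ℂ) else 0) -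
        if (1 : ℝ) = 0 then ({i : (Σ l : ℕ, Fin ((l + 2).choose 2)) | ((i.1 : ℝ) * (i.1 + 2)) = 0}.ncard : ℂ) else 0)) = (1 / 4) := by
    rw [Fintype.sum_sum_type]
    simp only [Sum.elim_inl, Sum.elim_inr, natCast_sub_three_halves_ne_neg_one, if_false, Finset.sum_const_zero, zero_add,
      threeHemisphereExponent_eq_iff (N + 1) h0N (-1) (by norm_num), Finset.sum_ite_eq', Finset.mem_univ, if_true,
      one_ne_zero, sub_zero, threeHemisphere_boundaryCoeff_zero, Complex.ofReal_one, Complex.Gamma_one, inv_one, one_mul]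
    push_cast
    ring
  rw [e] at h
  exact h

/-- **THE LEADING POLE: `Res_{s=3/2} ζ_D = Γ(3/2)^{−1}·√π/8 = ¼`** (`Γ(3/2) = √π/2`). [cite: Gilkey1995, §1.10 Lemma 1.10.1;
Berard1986, Ch. VII nº2 (`a₀ = Vol`)] -/
theorem tendsto_sub_three_halves_mul_dirichletThreeHemisphereZeta_continuation (N : ℕ) :
    Tendsto (fun s : ℂ ↦ (s - ((3 / 2 : ℝ) : ℂ)) * ((Complex.Gamma s)⁻¹ *
        (∑ k : Fin (N + 2) ⊕ Fin (N + 1), (((Sum.elim (fun k : Fin (N + 2) ↦ π ^ (1 / 2 : ℝ) / 8 / ((k : ℕ).factorial : ℝ))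
          (fun j : Fin (N + 1) ↦ (-1) * (1 / 4 : ℝ) * (∑ p ∈ Finset.HasAntidiagonal.antidiagonal (j : ℕ),
          1 / (p.1.factorial : ℝ) * ((-1 : ℝ) ^ p.2 * (bernoulli (2 * p.2) : ℝ) / (p.2.factorial : ℝ)))) k : ℝ)) : ℂ) / (s + ((Sum.elim (fun k : Fin (N + 2) ↦ ((k : ℕ) : ℝ) - 3 / 2) (fun j : Fin (N + 1) ↦ ((j : ℕ) : ℝ) - 1) k) : ℝ)) -
          ({i : (Σ l : ℕ, Fin ((l + 1).choose 2)) | ((i.1 : ℝ) * (i.1 + 2)) = 0}.ncard : ℂ) / s +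
        mellin (fun t : ℝ ↦ ((∑' i : {i : (Σ l : ℕ, Fin ((l + 1).choose 2)) | ((i.1 : ℝ) * (i.1 + 2)) ≠ 0},
            rexp (-(t * ((((i : (Σ l : ℕ, Fin ((l + 1).choose 2)))).1 : ℝ) * (((i : (Σ l : ℕ, Fin ((l + 1).choose 2)))).1 + 2)))) : ℝ) : ℂ) -
          (Ioc 0 1).indicator (fun t : ℝ ↦ ((∑ k : Fin (N + 2) ⊕ Fin (N + 1), Sum.elim (fun k : Fin (N + 2) ↦ π ^ (1 / 2 : ℝ) / 8 / ((k : ℕ).factorial : ℝ))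
          (fun j : Fin (N + 1) ↦ (-1) * (1 / 4 : ℝ) * (∑ p ∈ Finset.HasAntidiagonal.antidiagonal (j : ℕ),
          1 / (p.1.factorial : ℝ) * ((-1 : ℝ) ^ p.2 * (bernoulli (2 * p.2) : ℝ) / (p.2.factorial : ℝ)))) k *
            t ^ (Sum.elim (fun k : Fin (N + 2) ↦ ((k : ℕ) : ℝ) - 3 / 2) (fun j : Fin (N + 1) ↦ ((j : ℕ) : ℝ) - 1) k) : ℝ) : ℂ) -
            ({i : (Σ l : ℕ, Fin ((l + 1).choose 2)) | ((i.1 : ℝ) * (i.1 + 2)) = 0}.ncard : ℂ)) t) s)))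
      (𝓝[≠] ((3 / 2 : ℝ) : ℂ)) (𝓝 (1 / 4)) := by
  have hs₀ : -(N : ℝ) < 3 / 2 := by linarith [(N.cast_nonneg : (0 : ℝ) ≤ N)]
  have h := tendsto_sub_mul_continuation_nhdsNE (μ := fun i : (Σ l : ℕ, Fin ((l + 1).choose 2)) ↦ ((i.1 : ℝ) * (i.1 + 2)))
    (fun i ↦ by positivity) tendsto_dirichletThreeHemisphere_cofinite_atTop (fun t ht ↦ summable_dirichletThreeHemisphere ht)
    (isBigO_dirichletThreeHemisphere_heatTrace_expansion N) hs₀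
  have h0N : 0 < N + 2 := by omega
  have hG : Complex.Gamma ((3 / 2 : ℝ) : ℂ) = ((π ^ (1 / 2 : ℝ) / 2 : ℝ) : ℂ) := by
    rw [Complex.Gamma_ofReal, show (3 / 2 : ℝ) = 1 / 2 + 1 by norm_num, Real.Gamma_add_one (by norm_num),
      Real.Gamma_one_half_eq, Real.sqrt_eq_rpow]
    push_cast
    ring
  have e : ((Complex.Gamma ((3 / 2 : ℝ) : ℂ))⁻¹ *
      ((∑ k : Fin (N + 2) ⊕ Fin (N + 1), if Sum.elim (fun k : Fin (N + 2) ↦ ((k : ℕ) : ℝ) - 3 / 2) (fun j : Fin (N + 1) ↦ ((j : ℕ) : ℝ) - 1) k = -(3 / 2 : ℝ) then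
        (((Sum.elim (fun k : Fin (N + 2) ↦ π ^ (1 / 2 : ℝ) / 8 / ((k : ℕ).factorial : ℝ))
          (fun j : Fin (N + 1) ↦ (-1) * (1 / 4 : ℝ) * (∑ p ∈ Finset.HasAntidiagonal.antidiagonal (j : ℕ),
          1 / (p.1.factorial : ℝ) * ((-1 : ℝ) ^ p.2 * (bernoulli (2 * p.2) : ℝ) / (p.2.factorial : ℝ)))) k : ℝ)) : ℂ) else 0) -
        if (3 / 2 : ℝ) = 0 then ({i : (Σ l : ℕ, Fin ((l + 1).choose 2)) | ((i.1 : ℝ) * (i.1 + 2)) = 0}.ncard : ℂ) else 0)) = 1 / 4 := by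
    rw [hG, Fintype.sum_sum_type]
    simp only [Sum.elim_inl, Sum.elim_inr, threeHemisphereHalfExponent_eq_iff (N + 2) h0N (-(3 / 2)) (by norm_num),
      Finset.sum_ite_eq', Finset.mem_univ, if_true, natCast_sub_one_ne_neg_three_halves, if_false, Finset.sum_const_zero,
      add_zero, Nat.factorial_zero, Nat.cast_one, div_one, show ¬ ((3 / 2 : ℝ) = 0) by norm_num, sub_zero]
    have hq : ((π ^ (1 / 2 : ℝ) : ℝ) : ℂ) ≠ 0 := Complex.ofReal_ne_zero.mpr (by positivity)
    push_cast
    field_simp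
    norm_num
  rw [e] at h
  exact h

/-- **`ζ_D` IS REGULAR AT EVERY `s = −j`, WITH VALUE `(−1)ʲj!·(−¼d_{j+1})`** (`ζ_D(0) = −5/24`, `ζ_D(−1) = 19/240`): the
interior (half-integer) terms never meet the poles of `Γ`; the values at the non-positive integers are pure BOUNDARY data.
[cite: Gilkey1995, §1.10 Lemma 1.10.1; McKeanSinger1967, eq. (6) p. 45] -/
theorem exists_analyticAt_dirichletThreeHemisphereZeta_continuation_neg_natCast (j : ℕ) :
    ∃ Z : ℂ → ℂ, AnalyticAt ℂ Z (-(j : ℂ)) ∧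
      Z (-(j : ℂ)) = (-1) ^ j * (j.factorial : ℂ) *
        (((-1) * (1 / 4 : ℝ) * (∑ p ∈ Finset.HasAntidiagonal.antidiagonal (j + 1),
          1 / (p.1.factorial : ℝ) * ((-1 : ℝ) ^ p.2 * (bernoulli (2 * p.2) : ℝ) / (p.2.factorial : ℝ))) : ℝ) : ℂ) ∧
      ∀ᶠ s in 𝓝[≠] (-(j : ℂ)), Z s = (Complex.Gamma s)⁻¹ *
        (∑ k : Fin ((j + 1) + 2) ⊕ Fin ((j + 1) + 1), (((Sum.elim (fun k : Fin ((j + 1) + 2) ↦ π ^ (1 / 2 : ℝ) / 8 / ((k : ℕ).factorial : ℝ))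
          (fun j : Fin ((j + 1) + 1) ↦ (-1) * (1 / 4 : ℝ) * (∑ p ∈ Finset.HasAntidiagonal.antidiagonal (j : ℕ),
          1 / (p.1.factorial : ℝ) * ((-1 : ℝ) ^ p.2 * (bernoulli (2 * p.2) : ℝ) / (p.2.factorial : ℝ)))) k : ℝ)) : ℂ) / (s + ((Sum.elim (fun k : Fin ((j + 1) + 2) ↦ ((k : ℕ) : ℝ) - 3 / 2) (fun j : Fin ((j + 1) + 1) ↦ ((j : ℕ) : ℝ) - 1) k) : ℝ)) -
          ({i : (Σ l : ℕ, Fin ((l + 1).choose 2)) | ((i.1 : ℝ) * (i.1 + 2)) = 0}.ncard : ℂ) / s +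
        mellin (fun t : ℝ ↦ ((∑' i : {i : (Σ l : ℕ, Fin ((l + 1).choose 2)) | ((i.1 : ℝ) * (i.1 + 2)) ≠ 0},
            rexp (-(t * ((((i : (Σ l : ℕ, Fin ((l + 1).choose 2)))).1 : ℝ) * (((i : (Σ l : ℕ, Fin ((l + 1).choose 2)))).1 + 2)))) : ℝ) : ℂ) -
          (Ioc 0 1).indicator (fun t : ℝ ↦ ((∑ k : Fin ((j + 1) + 2) ⊕ Fin ((j + 1) + 1), Sum.elim (fun k : Fin ((j + 1) + 2) ↦ π ^ (1 / 2 : ℝ) / 8 / ((k : ℕ).factorial : ℝ))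
          (fun j : Fin ((j + 1) + 1) ↦ (-1) * (1 / 4 : ℝ) * (∑ p ∈ Finset.HasAntidiagonal.antidiagonal (j : ℕ),
          1 / (p.1.factorial : ℝ) * ((-1 : ℝ) ^ p.2 * (bernoulli (2 * p.2) : ℝ) / (p.2.factorial : ℝ)))) k *
            t ^ (Sum.elim (fun k : Fin ((j + 1) + 2) ↦ ((k : ℕ) : ℝ) - 3 / 2) (fun j : Fin ((j + 1) + 1) ↦ ((j : ℕ) : ℝ) - 1) k) : ℝ) : ℂ) -
            ({i : (Σ l : ℕ, Fin ((l + 1).choose 2)) | ((i.1 : ℝ) * (i.1 + 2)) = 0}.ncard : ℂ)) t) s) := by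
  have hβ : (j : ℝ) < (((j + 1 : ℕ)) : ℝ) := by push_cast; linarith
  obtain ⟨Z, hZ, hval, hev⟩ := exists_analyticAt_continuation_neg_natCast (μ := fun i : (Σ l : ℕ, Fin ((l + 1).choose 2)) ↦ ((i.1 : ℝ) * (i.1 + 2)))
    (fun i ↦ by positivity) tendsto_dirichletThreeHemisphere_cofinite_atTop (fun t ht ↦ summable_dirichletThreeHemisphere ht)
    (isBigO_dirichletThreeHemisphere_heatTrace_expansion (j + 1)) j hβ
  refine ⟨Z, hZ, ?_, hev⟩
  rw [hval, Fintype.sum_sum_type]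
  have hj : j + 1 < (j + 1) + 1 := by omega
  simp only [Sum.elim_inl, Sum.elim_inr, natCast_sub_three_halves_ne_natCast, if_false, Finset.sum_const_zero, zero_add,
    threeHemisphereExponent_eq_iff ((j + 1) + 1) hj (j : ℝ) (by push_cast; ring), Finset.sum_ite_eq', Finset.mem_univ,
    if_true, ncard_setOf_dirichletThreeHemisphere_eq_zero, Nat.cast_zero, ite_self, sub_zero]

end Literature.Analysis.InnerProduct
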